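import Literature.Topology.FourManifolds.SpikedLoop
import HarnessLib

/-!
# Cone geometry at the crossing point: depth, the sign of the spikes and the cone condition

Topic `Literature/Topology/FourManifolds` (trunk T-4MAN). Fact seat
`provefact-Literature.Topology.FourManifolds.Knot.IsConnectedSum.isIsotopic` (Schubert's theorem),
stage S1 of the proof of the geometric heart for rail knots. The scaling stage contracts the
southern content of the spiked knot towards the centre `oS = pZero + κ frame (1, 0, σ)` along
straight chords of the chart `ψ` (from the north pole). This file provides the metric bookkeeping
for the chords:

* `depth y = 4 - ‖y‖²` on the chart: positive exactly on the image of the open southern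
  hemisphere (`depth_pos_iff`, `norm_psiN_lt_two_iff`), concave, so that a chord has depth at
  least the minimum of the depths of its ends (`min_depth_le_depth_chord`);
* the **depth covector** `b.rho hcross Y = -2 ⟪pZero, frame Y⟫` with the exact expansion
  `depth (blowDown κ Y) = κ ρ(Y) - κ² ‖frame Y‖²` (`depth_blowDown`); in normal position
  `ρ(Y) = ρ₁ Y₀ + ρ₃ Y₂` with `ρ₁ = -2⟪pZero, fZero⟫ ≥ 0` and `(ρ₁, ρ₃) ≠ 0` (`rho_apply`,
  `rhoOne_nonneg`, `mZero_pos`);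
* the **sign of the spikes** `b.depthSign = ±1`, chosen so that `σ ρ₃ = |ρ₃|`, and the **depth
  margin** `b.mZero = ρ₁ + |ρ₃| > 0`: the centre `oS` at sign `σ` has depth `κ mZero - O(κ²)`
  (`depth_oS`);
* the **junction parameters** `juncLo`, `juncHi` (blown-up parameter `3/8` on the two spikes) and
  the **content set** `contentSet = [juncLo, juncHi]`; where the spiked knot at `u = 1` is: on the
  flat part of the cores `ψ⁻¹ (pieceLo κ σ 1 (α t))` (`spikePiece_one_coreLo`), in the open north
  before/after the cores and on the cores where `α < 0` (`spikePiece_one_north_of_lt`, …), in the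
  compact **far southern set** `farSouth g ⊆` open south between the cores and on the non-flat core
  content (`spikePiece_one_mem_farSouth_middle`, `exists_depth_farSouth`);
* the four separation mechanisms for a chord `oS + μ (Y - oS)` (`chord_ne_of_blowUp_zero`: first
  blow-up coordinate; `psiN_symm_chord_ne_of_north`: hemispheres; `chord_ne_of_depth`: depth;
  and the far set of `SpikedLoop.lean`), the flat estimates (`blowUp_pieceLo_one_zero_lt`: walls
  have first coordinate `< 3/8`; `le_blowUp_pieceLo_one_zero`: content `≥ 3/8`;
  `depth_pieceLo_one_le`: southern walls have depth `≤ κ m₀ (3/8 + 11ε/8) < κ m₀ / 2`);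
* the **cone scale** hypotheses `BandData.ConeScale` (spike scale at `σ = depthSign`, `ε ≤ 1/16`,
  centre depth, far depth, far distance at the half threshold), `exists_coneScale` (they hold for
  all small `κ`), the classifications `content_cases`, `wall_cases`, and **the cone condition**
  `BandData.cone`: in normal position every chord from `oS` to the chart value `Ypt s` of a content
  point, read back on the sphere, avoids every wall point of the spiked knot.

Everything is proved; no named facts are introduced.

## References

Standard; all statements `[folklore]`.
-/

open scoped Manifold ContDiff Topology Real RealInnerProductSpace
open Function Set Metric Filter

noncomputable section

namespace Literature.Topology.FourManifolds

/-- Local notation: `𝔼 n` is the model Euclidean space `EuclideanSpace ℝ (Fin n)`. -/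
local notation "𝔼 " n:arg => EuclideanSpace ℝ (Fin n)

/-- Local notation: `𝕊 n` is the unit sphere in `EuclideanSpace ℝ (Fin (n + 1))`. -/
local notation "𝕊 " n:arg => (Metric.sphere (0 : EuclideanSpace ℝ (Fin (n + 1))) 1)

attribute [local instance] fact_finrank_euclideanSpace_succ

open KnotsInBall

/-! ### Depth in the chart -/

/-- **Depth** in the chart from the north pole: `4 - ‖y‖²`; positive exactly on the image of the
open southern hemisphere. [folklore] -/
def depth (y : 𝔼 3) : ℝ := 4 - ‖y‖ ^ 2

/-- Depth is positive iff the norm is `< 2`. [folklore] -/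
theorem depth_pos_iff (y : 𝔼 3) : 0 < depth y ↔ ‖y‖ < 2 := by
  rw [depth, sub_pos]
  constructor
  · intro h; nlinarith [norm_nonneg y]
  · intro h; nlinarith [norm_nonneg y]

/-- Depth is nonpositive iff the norm is `≥ 2`. [folklore] -/
theorem depth_nonpos_iff (y : 𝔼 3) : depth y ≤ 0 ↔ 2 ≤ ‖y‖ := by
  rw [← not_lt, depth_pos_iff, not_lt]

/-- **A chart point of positive depth comes from the open southern hemisphere.** [folklore] -/
theorem psiN_symm_last_neg_of_depth_pos {y : 𝔼 3} (hy : 0 < depth y) :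
    ((psiN.symm y : 𝕊 3) : 𝔼 4) (Fin.last 3) < 0 := by
  have h := (norm_psiN_lt_two_iff (psiN_symm_ne_northPole y)).1
  rw [psiN_apply_psiN_symm] at h
  exact h ((depth_pos_iff y).1 hy)

/-- A point of the closed northern hemisphere other than the pole has nonpositive depth in the
chart. [folklore] -/
theorem depth_psiN_nonpos_of_last_nonneg {x : 𝕊 3} (hx : x ≠ northPole) (h : 0 ≤ (x : 𝔼 4) (Fin.last 3)) :
    depth (psiN x) ≤ 0 := by
  rw [depth_nonpos_iff]
  by_contra hlt
  push Not at hlt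
  have := (norm_psiN_lt_two_iff hx).1 hlt
  linarith

/-- **A chart point of positive depth is not a point of the closed northern hemisphere.**
[folklore] -/
theorem psiN_symm_ne_of_depth_pos {y : 𝔼 3} (hy : 0 < depth y) {x : 𝕊 3} (h : 0 ≤ (x : 𝔼 4) (Fin.last 3)) :
    psiN.symm y ≠ x := by
  intro he
  have := psiN_symm_last_neg_of_depth_pos hy
  rw [he] at this
  linarith

/-- **Depth along a chord**: the depth of `o + μ (Y - o)`, `μ ∈ [0, 1]`, is at least the minimum
of the depths of `o` and `Y` (concavity of `4 - ‖·‖²`). [folklore] -/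
theorem min_depth_le_depth_chord (o Y : 𝔼 3) {μ : ℝ} (hμ : μ ∈ Icc (0 : ℝ) 1) :
    min (depth o) (depth Y) ≤ depth (o + μ • (Y - o)) := by
  have e : o + μ • (Y - o) = (1 - μ) • o + μ • Y := by module
  rw [e, depth, depth, depth]
  have hn : ‖(1 - μ) • o + μ • Y‖ ≤ (1 - μ) * ‖o‖ + μ * ‖Y‖ := by
    refine (norm_add_le _ _).trans ?_
    rw [norm_smul, norm_smul, Real.norm_eq_abs, Real.norm_eq_abs, abs_of_nonneg (by linarith [hμ.2]),
      abs_of_nonneg hμ.1]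
  have hM : (1 - μ) * ‖o‖ + μ * ‖Y‖ ≤ max ‖o‖ ‖Y‖ := by
    have h1 := le_max_left ‖o‖ ‖Y‖; have h2 := le_max_right ‖o‖ ‖Y‖
    nlinarith [hμ.1, hμ.2]
  have h3 : ‖(1 - μ) • o + μ • Y‖ ^ 2 ≤ (max ‖o‖ ‖Y‖) ^ 2 :=
    pow_le_pow_left₀ (norm_nonneg _) (hn.trans hM) 2
  rcases le_total ‖o‖ ‖Y‖ with h | h
  · rw [max_eq_right h] at h3
    have : min (4 - ‖o‖ ^ 2) (4 - ‖Y‖ ^ 2) ≤ 4 - ‖Y‖ ^ 2 := min_le_right _ _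
    linarith
  · rw [max_eq_left h] at h3
    have : min (4 - ‖o‖ ^ 2) (4 - ‖Y‖ ^ 2) ≤ 4 - ‖o‖ ^ 2 := min_le_left _ _
    linarith

/-- A chord between points of positive depth has positive depth. [folklore] -/
theorem depth_chord_pos {o Y : 𝔼 3} (ho : 0 < depth o) (hY : 0 < depth Y) {μ : ℝ} (hμ : μ ∈ Icc (0 : ℝ) 1) :
    0 < depth (o + μ • (Y - o)) :=
  lt_of_lt_of_le (lt_min ho hY) (min_depth_le_depth_chord o Y hμ)

namespace BandData

variable {A B K : Knot} {avoid : Set (𝕊 3)} (b : BandData A B K avoid)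
  (hcross : b.band ⁻¹' sphereEquator 2 ∩ squareNhd b.δ = {x ∈ squareNhd b.δ | x 0 = 2⁻¹})

/-! ### The depth covector -/

/-- **The depth covector** `ρ(Y) = -2 ⟪pZero, frame Y⟫`: the linear part of the depth at the
crossing point in blow-up coordinates. [folklore] -/
def rho (Y : 𝔼 3) : ℝ := -2 * ⟪b.pZero, b.frame hcross Y⟫

/-- `ρ₁ = -2 ⟪pZero, fZero⟫`. [folklore] -/
def rhoOne : ℝ := -2 * ⟪b.pZero, b.fZero⟫

/-- `ρ₃ = -2 ⟪pZero, gTwo⟫`. [folklore] -/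
def rhoThree : ℝ := -2 * ⟪b.pZero, b.gTwo⟫

/-- **Exact expansion of the depth in blow-up coordinates**:
`depth (blowDown κ Y) = κ ρ(Y) - κ² ‖frame Y‖²`. [folklore] -/
theorem depth_blowDown (κ : ℝ) (Y : 𝔼 3) :
    depth (b.blowDown hcross κ Y) = κ * b.rho hcross Y - κ ^ 2 * ‖b.frame hcross Y‖ ^ 2 := by
  rw [depth, blowDown, rho]
  have h := norm_add_sq_real b.pZero (κ • b.frame hcross Y)
  rw [b.norm_pZero hcross, inner_smul_right, norm_smul, mul_pow, Real.norm_eq_abs, sq_abs] at h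
  rw [h]; ring

/-- **In normal position the depth covector has no component along the middle line**:
`ρ(Y) = ρ₁ Y₀ + ρ₃ Y₂`. [folklore] -/
theorem rho_apply (Y : 𝔼 3) : b.rho hcross Y = b.rhoOne * Y 0 + b.rhoThree * Y 2 := by
  rw [rho, frame_apply, inner_add_right, inner_add_right, inner_smul_right, inner_smul_right,
    inner_smul_right, b.inner_pZero_fOne hcross, rhoOne, rhoThree]
  ring

/-- `ρ` on the coordinate point `(x, y, z)`. [folklore] -/
theorem rho_pt3 (x y z : ℝ) : b.rho hcross (pt3 x y z) = b.rhoOne * x + b.rhoThree * z := by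
  rw [rho_apply]; rfl

variable (hB : B.InSouth)
include hcross hB in
/-- **`ρ₁ ≥ 0`**: to the right of the middle line the band is inside the ball. [folklore] -/
theorem rhoOne_nonneg : 0 ≤ b.rhoOne := by
  have := b.inner_pZero_fZero_nonpos hB hcross
  rw [rhoOne]; linarith

include hcross in
/-- **`(ρ₁, ρ₃) ≠ 0`**: otherwise `pZero` would be orthogonal to the whole frame, hence zero.
[folklore] -/
theorem rhoOne_ne_zero_or_rhoThree_ne_zero : b.rhoOne ≠ 0 ∨ b.rhoThree ≠ 0 := by
  by_contra h
  push Not at h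
  obtain ⟨h1, h3⟩ := h
  have hall : ∀ Y : 𝔼 3, ⟪b.pZero, b.frame hcross Y⟫ = 0 := by
    intro Y
    have := b.rho_apply hcross Y
    rw [h1, h3, zero_mul, zero_mul, add_zero, rho] at this
    linarith
  have h0 := hall ((b.frame hcross).symm b.pZero)
  rw [ContinuousLinearEquiv.apply_symm_apply, real_inner_self_eq_norm_sq, b.norm_pZero hcross] at h0
  norm_num at h0

/-- **The sign of the spikes**: `+1` if `ρ₃ ≥ 0`, `-1` otherwise. [folklore] -/
def depthSign : ℝ := if 0 ≤ b.rhoThree then 1 else -1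

/-- `|σ| = 1`. [folklore] -/
theorem abs_depthSign : |b.depthSign| = 1 := by
  rw [depthSign]; split_ifs <;> simp

/-- `|σ| ≤ 1`. [folklore] -/
theorem abs_depthSign_le : |b.depthSign| ≤ 1 := b.abs_depthSign.le

/-- `σ ρ₃ = |ρ₃|`. [folklore] -/
theorem depthSign_mul_rhoThree : b.depthSign * b.rhoThree = |b.rhoThree| := by
  rw [depthSign]
  split_ifs with h
  · rw [one_mul, abs_of_nonneg h]
  · rw [neg_one_mul, abs_of_neg (not_le.1 h)]

/-- `σ² = 1`. [folklore] -/
theorem depthSign_sq : b.depthSign ^ 2 = 1 := by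
  rw [depthSign]; split_ifs <;> norm_num

/-- **The depth margin** `m₀ = ρ₁ + |ρ₃|`. [folklore] -/
def mZero : ℝ := b.rhoOne + |b.rhoThree|

include hcross hB in
/-- The depth margin is positive. [folklore] -/
theorem mZero_pos : 0 < b.mZero := by
  have h1 := b.rhoOne_nonneg hcross hB
  rw [mZero]
  rcases b.rhoOne_ne_zero_or_rhoThree_ne_zero hcross with h | h
  · have : 0 < b.rhoOne := lt_of_le_of_ne h1 (Ne.symm h)
    linarith [abs_nonneg b.rhoThree]
  · have : 0 < |b.rhoThree| := abs_pos.2 h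
    linarith

/-- The depth covector of the centre direction `(1, 0, σ)` is the depth margin. [folklore] -/
theorem rho_centre : b.rho hcross (pt3 1 0 b.depthSign) = b.mZero := by
  rw [rho_pt3, mul_one, mZero, mul_comm, depthSign_mul_rhoThree]

/-- **Depth of the centre**: `depth oS = κ m₀ - κ² ‖frame (1, 0, σ)‖²`. [folklore] -/
theorem depth_oS (κ : ℝ) :
    depth (b.oS hcross κ b.depthSign) = κ * b.mZero - κ ^ 2 * ‖b.frame hcross (pt3 1 0 b.depthSign)‖ ^ 2 := by
  rw [oS, depth_blowDown, rho_centre]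

include hB in
/-- The centre has depth at least `κ m₀ / 2` once `κ ‖frame (1, 0, σ)‖² ≤ m₀ / 2` (and `κ ≥ 0`).
[folklore] -/
theorem depth_oS_ge {κ : ℝ} (hκ : 0 ≤ κ) (hsmall : κ * ‖b.frame hcross (pt3 1 0 b.depthSign)‖ ^ 2 ≤ b.mZero / 2) :
    κ * b.mZero / 2 ≤ depth (b.oS hcross κ b.depthSign) := by
  rw [depth_oS]
  have := b.mZero_pos hcross hB
  nlinarith

/-! ### Depth of blown-down points: the linear bound -/

/-- **The depth of a blown-down point is at most `κ ρ`.** [folklore] -/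
theorem depth_blowDown_le (κ : ℝ) (Y : 𝔼 3) : depth (b.blowDown hcross κ Y) ≤ κ * b.rho hcross Y := by
  rw [depth_blowDown]; nlinarith [sq_nonneg κ, norm_nonneg (b.frame hcross Y)]

/-- The depth covector is bounded by `(|ρ₁| + |ρ₃|) ‖Y‖`. [folklore] -/
theorem abs_rho_le (Y : 𝔼 3) : |b.rho hcross Y| ≤ (|b.rhoOne| + |b.rhoThree|) * ‖Y‖ := by
  rw [rho_apply]
  have h0 := BandFoliation.abs_apply_le_norm Y 0
  have h2 := BandFoliation.abs_apply_le_norm Y 2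
  calc |b.rhoOne * Y 0 + b.rhoThree * Y 2| ≤ |b.rhoOne * Y 0| + |b.rhoThree * Y 2| := abs_add_le _ _
    _ = |b.rhoOne| * |Y 0| + |b.rhoThree| * |Y 2| := by rw [abs_mul, abs_mul]
    _ ≤ |b.rhoOne| * ‖Y‖ + |b.rhoThree| * ‖Y‖ := by gcongr
    _ = _ := by ring

/-- The depth covector is `‖·‖`-Lipschitz with the same constant: `|ρ Y - ρ Y'| ≤ (|ρ₁| + |ρ₃|) ‖Y - Y'‖`.
[folklore] -/
theorem abs_rho_sub_le (Y Y' : 𝔼 3) : |b.rho hcross Y - b.rho hcross Y'| ≤ (|b.rhoOne| + |b.rhoThree|) * ‖Y - Y'‖ := by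
  have e : b.rho hcross Y - b.rho hcross Y' = b.rho hcross (Y - Y') := by
    simp only [rho, map_sub, inner_sub_right]; ring
  rw [e]; exact b.abs_rho_le hcross _

/-! ### The spiked pieces at `u = 1` on the model range -/

/-- **On `[1/4, 3]` the final lower piece is the blown-down lower model path.** [folklore] -/
theorem pieceLo_one_of_mem {κ σ α : ℝ} (hα : α ∈ Icc (1 / 4 : ℝ) 3) :
    b.pieceLo hcross κ σ 1 α = b.blowDown hcross κ (modelLo σ α) := by
  simp [pieceLo, spikeBump_eq_one hα]

/-- On `[1/4, 3]` the final upper piece is the blown-down upper model path. [folklore] -/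
theorem pieceHi_one_of_mem {κ σ α : ℝ} (hα : α ∈ Icc (1 / 4 : ℝ) 3) :
    b.pieceHi hcross κ σ 1 α = b.blowDown hcross κ (modelHi σ α) := by
  simp [pieceHi, spikeBump_eq_one hα]

/-- Blow-up coordinates of the final lower piece on `[1/4, 3]`. [folklore] -/
theorem blowUp_pieceLo_one_of_mem {κ : ℝ} (hκ : κ ≠ 0) {σ α : ℝ} (hα : α ∈ Icc (1 / 4 : ℝ) 3) :
    b.blowUp hcross κ (b.pieceLo hcross κ σ 1 α) = modelLo σ α := by
  rw [b.pieceLo_one_of_mem hcross hα, b.blowUp_blowDown hcross hκ]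

/-- Blow-up coordinates of the final upper piece on `[1/4, 3]`. [folklore] -/
theorem blowUp_pieceHi_one_of_mem {κ : ℝ} (hκ : κ ≠ 0) {σ α : ℝ} (hα : α ∈ Icc (1 / 4 : ℝ) 3) :
    b.blowUp hcross κ (b.pieceHi hcross κ σ 1 α) = modelHi σ α := by
  rw [b.pieceHi_one_of_mem hcross hα, b.blowUp_blowDown hcross hκ]

/-! ### The junction parameters and the content set -/

section Junction

variable {κ : ℝ} (hκ : 0 < κ) (h7 : 7 * κ ≤ b.gapLo) (h7' : 7 * κ ≤ b.gapHi)
include hκ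

include h7 in
/-- There is a parameter in the right half of the lower core with blown-up parameter `3/8`.
[folklore] -/
theorem exists_juncLo : ∃ t ∈ Icc b.tcLo (b.tcLo + b.epsLo / 8), b.alphaLo κ t = 3 / 8 := by
  have hε := b.epsLo_bounds.1
  have h0 : b.alphaLo κ b.tcLo = 0 := by rw [alphaLo, chiLo_tcLo]; simp
  have h1 : 7 ≤ b.alphaLo κ (b.tcLo + b.epsLo / 8) := by
    rw [alphaLo, le_div_iff₀ hκ]
    have : b.gapLo ≤ b.chiLo (b.tcLo + b.epsLo / 8) - 1 / 2 := min_le_left _ _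
    linarith
  have hcont : ContinuousOn (b.alphaLo κ) (Icc b.tcLo (b.tcLo + b.epsLo / 8)) := (b.contDiff_alphaLo κ).continuous.continuousOn
  have hmem : (3 / 8 : ℝ) ∈ Icc (b.alphaLo κ b.tcLo) (b.alphaLo κ (b.tcLo + b.epsLo / 8)) := ⟨by rw [h0]; norm_num, by linarith⟩
  obtain ⟨t, ht, hteq⟩ := intermediate_value_Icc (by linarith) hcont hmem
  exact ⟨t, ht, hteq⟩

include h7' in
/-- There is a parameter in the left half of the upper core with blown-up parameter `3/8`.
[folklore] -/
theorem exists_juncHi : ∃ t ∈ Icc (b.tcHi - b.epsHi / 8) b.tcHi, b.alphaHi κ t = 3 / 8 := by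
  have hε := b.epsHi_bounds.1
  have h0 : b.alphaHi κ b.tcHi = 0 := by rw [alphaHi, chiHi_tcHi]; simp
  have h1 : 7 ≤ b.alphaHi κ (b.tcHi - b.epsHi / 8) := by
    rw [alphaHi, le_div_iff₀ hκ]
    have : b.gapHi ≤ b.chiHi (b.tcHi - b.epsHi / 8) - 1 / 2 := min_le_left _ _
    linarith
  have hcont : ContinuousOn (b.alphaHi κ) (Icc (b.tcHi - b.epsHi / 8) b.tcHi) := (b.contDiff_alphaHi κ).continuous.continuousOn
  have hmem : (3 / 8 : ℝ) ∈ Icc (b.alphaHi κ b.tcHi) (b.alphaHi κ (b.tcHi - b.epsHi / 8)) := ⟨by rw [h0]; norm_num, by linarith⟩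
  obtain ⟨t, ht, hteq⟩ := intermediate_value_Icc' (by linarith) hcont hmem
  exact ⟨t, ht, hteq⟩

include h7 in
/-- **The lower junction parameter** (chosen): blown-up parameter `3/8` on the lower spike.
[folklore] -/
def juncLo : ℝ := (b.exists_juncLo hκ h7).choose

include h7 in
/-- The lower junction parameter lies in `[tcLo, tcLo + ε/8]` and has `α = 3/8`. [folklore] -/
theorem juncLo_spec : b.juncLo hκ h7 ∈ Icc b.tcLo (b.tcLo + b.epsLo / 8) ∧ b.alphaLo κ (b.juncLo hκ h7) = 3 / 8 :=
  (b.exists_juncLo hκ h7).choose_spec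

include h7' in
/-- **The upper junction parameter** (chosen). [folklore] -/
def juncHi : ℝ := (b.exists_juncHi hκ h7').choose

include h7' in
/-- The upper junction parameter lies in `[tcHi - ε'/8, tcHi]` and has `α = 3/8`. [folklore] -/
theorem juncHi_spec : b.juncHi hκ h7' ∈ Icc (b.tcHi - b.epsHi / 8) b.tcHi ∧ b.alphaHi κ (b.juncHi hκ h7') = 3 / 8 :=
  (b.exists_juncHi hκ h7').choose_spec

include h7 h7' in
/-- **The content set**: the closed parameter interval between the two junctions. [folklore] -/
def contentSet : Set ℝ := Icc (b.juncLo hκ h7) (b.juncHi hκ h7')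

include h7 in
/-- The lower junction lies in the closed lower core. [folklore] -/
theorem juncLo_mem_core : b.juncLo hκ h7 ∈ Icc (b.tcLo - b.epsLo / 8) (b.tcLo + b.epsLo / 8) := by
  have h := (b.juncLo_spec hκ h7).1
  have hε := b.epsLo_bounds.1
  exact ⟨by linarith [h.1], h.2⟩

include h7' in
/-- The upper junction lies in the closed upper core. [folklore] -/
theorem juncHi_mem_core : b.juncHi hκ h7' ∈ Icc (b.tcHi - b.epsHi / 8) (b.tcHi + b.epsHi / 8) := by
  have h := (b.juncHi_spec hκ h7').1
  have hε := b.epsHi_bounds.1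
  exact ⟨h.1, by linarith [h.2]⟩

omit hκ in
/-- The cores are ordered: `tcLo + ε/8 < tcHi - ε'/8`. [folklore] -/
theorem coreLo_lt_coreHi : b.tcLo + b.epsLo / 8 < b.tcHi - b.epsHi / 8 := by
  obtain ⟨h1, h2, hε⟩ := b.tcLo_window
  obtain ⟨h3, h4, hε'⟩ := b.tcHi_window
  have hm := b.marks_lt
  linarith

/-- **Walls below the content set**: a parameter `t < juncLo` of the closed lower core has
`α t < 3/8`. [folklore] -/
theorem alphaLo_lt_of_lt_juncLo {t : ℝ} (ht : t ∈ Icc (b.tcLo - b.epsLo / 8) (b.tcLo + b.epsLo / 8))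
    (hlt : t < b.juncLo hκ h7) : b.alphaLo κ t < 3 / 8 := by
  rw [← (b.juncLo_spec hκ h7).2]
  exact b.strictMonoOn_alphaLo hκ ht (b.juncLo_mem_core hκ h7) hlt

/-- Walls above the content set: a parameter `t > juncHi` of the closed upper core has `α t < 3/8`.
[folklore] -/
theorem alphaHi_lt_of_juncHi_lt {t : ℝ} (ht : t ∈ Icc (b.tcHi - b.epsHi / 8) (b.tcHi + b.epsHi / 8))
    (hlt : b.juncHi hκ h7' < t) : b.alphaHi κ t < 3 / 8 := by
  rw [← (b.juncHi_spec hκ h7').2]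
  exact b.strictAntiOn_alphaHi hκ (b.juncHi_mem_core hκ h7') ht hlt

/-- **Content on the lower core has `α ≥ 3/8`.** [folklore] -/
theorem le_alphaLo_of_juncLo_le {s : ℝ} (hs : s ∈ Icc (b.tcLo - b.epsLo / 8) (b.tcLo + b.epsLo / 8))
    (hle : b.juncLo hκ h7 ≤ s) : 3 / 8 ≤ b.alphaLo κ s := by
  rw [← (b.juncLo_spec hκ h7).2]
  exact (b.strictMonoOn_alphaLo hκ).monotoneOn (b.juncLo_mem_core hκ h7) hs hle

/-- Content on the upper core has `α ≥ 3/8`. [folklore] -/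
theorem le_alphaHi_of_le_juncHi {s : ℝ} (hs : s ∈ Icc (b.tcHi - b.epsHi / 8) (b.tcHi + b.epsHi / 8))
    (hle : s ≤ b.juncHi hκ h7') : 3 / 8 ≤ b.alphaHi κ s := by
  rw [← (b.juncHi_spec hκ h7').2]
  exact (b.strictAntiOn_alphaHi hκ).antitoneOn hs (b.juncHi_mem_core hκ h7') hle

end Junction

/-! ### The far southern set: where the far content lives, uniformly in `κ` -/

omit b in
/-- The far southern planar set: `x₀ ∈ [1/2 + g, 1]`, height in `[1/10, 9/10]`. [folklore] -/
def farSouthPlanar (g : ℝ) : Set (𝔼 2) :=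
  {p | p 0 ∈ Icc (1 / 2 + g) 1 ∧ p 1 ∈ Icc (10⁻¹ : ℝ) (9 / 10)}

omit b in
/-- The far southern planar set is compact (for `g ≥ 0`). [folklore] -/
theorem isCompact_farSouthPlanar {g : ℝ} (hg : 0 ≤ g) : IsCompact (farSouthPlanar g) := by
  refine Metric.isCompact_of_isClosed_isBounded ?_ ?_
  · have h0 : Continuous fun p : 𝔼 2 ↦ p 0 := (EuclideanSpace.proj (0 : Fin 2)).continuous
    have h1 : Continuous fun p : 𝔼 2 ↦ p 1 := (EuclideanSpace.proj (1 : Fin 2)).continuous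
    exact (isClosed_Icc.preimage h0).inter (isClosed_Icc.preimage h1)
  · refine (Metric.isBounded_closedBall (x := (0 : 𝔼 2)) (r := 2)).subset fun p hp ↦ ?_
    rw [mem_closedBall, dist_zero_right]
    have e : p = pt2 (p 0) (p 1) := by ext i; fin_cases i <;> rfl
    rw [e]
    refine (norm_pt2_le _ _).trans ?_
    rw [abs_of_nonneg (by linarith [hp.1.1] : (0:ℝ) ≤ p 0), abs_of_nonneg (by linarith [hp.2.1] : (0:ℝ) ≤ p 1)]
    linarith [hp.1.2, hp.2.2]

/-- The far southern planar set lies in the open collar square (for `g > -1/2 - δ`, in particular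
for `g ≥ 0`). [folklore] -/
theorem farSouthPlanar_subset_squareNhd {g : ℝ} (hg : 0 ≤ g) : farSouthPlanar g ⊆ squareNhd b.δ := by
  intro p hp
  have hδ := b.δ_pos
  rw [mem_squareNhd_iff, Fin.forall_fin_two]
  exact ⟨⟨by linarith [hp.1.1], by linarith [hp.1.2]⟩, ⟨by linarith [hp.2.1], by linarith [hp.2.2]⟩⟩

/-- **The far southern set** on the sphere: the band image of the far southern planar set together
with the summand `B`. [folklore] -/
def farSouth (g : ℝ) : Set (𝕊 3) := b.band '' farSouthPlanar g ∪ range B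

/-- The far southern set is compact (for `g ≥ 0`). [folklore] -/
theorem isCompact_farSouth {g : ℝ} (hg : 0 ≤ g) : IsCompact (b.farSouth g) :=
  ((isCompact_farSouthPlanar hg).image b.contMDiff.continuous).union (isCompact_range B.continuous)

include hcross hB in
/-- **The far southern set lies in the open southern hemisphere** (`g > 0`). [folklore] -/
theorem farSouth_last_neg {g : ℝ} (hg : 0 < g) {x : 𝕊 3} (hx : x ∈ b.farSouth g) : (x : 𝔼 4) (Fin.last 3) < 0 := by
  rcases hx with ⟨p, hp, rfl⟩ | ⟨θ, rfl⟩
  · exact b.band_last_neg_of_half_lt hB hcross (b.farSouthPlanar_subset_squareNhd hg.le hp) (by linarith [hp.1.1])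
  · exact hB θ

include hcross hB in
/-- **The far southern set has depth bounded below** by a positive constant. [folklore] -/
theorem exists_depth_farSouth {g : ℝ} (hg : 0 < g) : ∃ d > 0, ∀ x ∈ b.farSouth g, d ≤ depth (psiN x) := by
  obtain ⟨r₀, hr₀, hr₂, hle⟩ := exists_norm_psiN_le_of_isCompact (b.isCompact_farSouth hg.le) (fun x hx ↦ b.farSouth_last_neg hcross hB hg hx)
  refine ⟨4 - r₀ ^ 2, by nlinarith, fun x hx ↦ ?_⟩
  have := hle x hx
  rw [depth]; nlinarith [norm_nonneg (psiN x)]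

/-! ### Where the spiked knot is: values on the cores, the middle and the outer stretches -/

section Scale

variable {hcross} {σ ε r A' κ : ℝ} (h : b.SpikeScale hcross σ ε r A' κ)
include h

omit h in
/-- A parameter of the closed lower core outside the spike set's lower part. [folklore] -/
theorem not_mem_spikeSet_of_coreLo {t : ℝ} (ht : t ∈ Icc (b.tcLo - b.epsLo / 8) (b.tcLo + b.epsLo / 8))
    (hα : b.alphaLo κ t ∉ Icc (-1 : ℝ) 6) : t ∉ b.spikeSet κ := by
  rintro (⟨-, hmem⟩ | ⟨hc, -⟩)
  · exact hα hmem
  · have := b.coreLo_lt_coreHi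
    linarith [ht.2, hc.1]

omit h in
/-- A parameter of the closed upper core outside the spike set's upper part. [folklore] -/
theorem not_mem_spikeSet_of_coreHi {t : ℝ} (ht : t ∈ Icc (b.tcHi - b.epsHi / 8) (b.tcHi + b.epsHi / 8))
    (hα : b.alphaHi κ t ∉ Icc (-1 : ℝ) 6) : t ∉ b.spikeSet κ := by
  rintro (⟨hc, -⟩ | ⟨-, hmem⟩)
  · have := b.coreLo_lt_coreHi
    linarith [ht.1, hc.2]
  · exact hα hmem

/-- **On the closed lower core, in the flat regime, the spiked piece function at `u = 1` is
`ψ⁻¹ (pieceLo κ σ 1 (α t))`** (on the spike set by construction; off it both are the rail).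
[folklore] -/
theorem spikePiece_one_coreLo {t : ℝ} (ht : t ∈ Icc (b.tcLo - b.epsLo / 8) (b.tcLo + b.epsLo / 8))
    (hq : ‖(pt2 (κ * b.alphaLo κ t) (-κ) : 𝔼 2)‖ < r) :
    b.spikePiece hcross κ σ 1 t = ((psiN.symm (b.pieceLo hcross κ σ 1 (b.alphaLo κ t)) : 𝕊 3) : 𝔼 4) := by
  by_cases hα : |b.alphaLo κ t| < 7
  · exact b.spikePiece_coreLo hcross h.κ_pos h.κ_le h.eight_le_poleRad σ 1 ht hα
  · have hα' : b.alphaLo κ t ∉ Icc (-1 : ℝ) 6 := fun hm ↦ hα (b.abs_alphaLo_lt_of_mem hm)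
    have hα'' : b.alphaLo κ t ∉ Ioo (1 / 8 : ℝ) 4 := fun hm ↦ hα' ⟨by linarith [hm.1], by linarith [hm.2]⟩
    rw [b.spikePiece_eq_neckPiece' h 1 (b.not_mem_spikeSet_of_coreLo ht hα'), b.neckPiece_eq_coreLo_flat h ht hq,
      b.pieceLo_eq_rail hcross hα'']

/-- On the closed upper core, in the flat regime, the spiked piece function at `u = 1` is
`ψ⁻¹ (pieceHi κ σ 1 (α t))`. [folklore] -/
theorem spikePiece_one_coreHi {t : ℝ} (ht : t ∈ Icc (b.tcHi - b.epsHi / 8) (b.tcHi + b.epsHi / 8))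
    (hq : ‖(pt2 (κ * b.alphaHi κ t) κ : 𝔼 2)‖ < r) :
    b.spikePiece hcross κ σ 1 t = ((psiN.symm (b.pieceHi hcross κ σ 1 (b.alphaHi κ t)) : 𝕊 3) : 𝔼 4) := by
  by_cases hα : |b.alphaHi κ t| < 7
  · exact b.spikePiece_coreHi hcross h.κ_pos h.κ_le h.eight_le_poleRad σ 1 ht hα
  · have hα' : b.alphaHi κ t ∉ Icc (-1 : ℝ) 6 := fun hm ↦ hα (b.abs_alphaHi_lt_of_mem hm)
    have hα'' : b.alphaHi κ t ∉ Ioo (1 / 8 : ℝ) 4 := fun hm ↦ hα' ⟨by linarith [hm.1], by linarith [hm.2]⟩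
    rw [b.spikePiece_eq_neckPiece' h 1 (b.not_mem_spikeSet_of_coreHi ht hα'), b.neckPiece_eq_coreHi_flat h ht hq,
      b.pieceHi_eq_rail hcross hα'']

/-- **On the closed lower core left of the turn (`α t ≤ 1/8`) the spiked piece function is the band
point `(χ₁ t, 1/2 - κ)`.** [folklore] -/
theorem spikePiece_one_coreLo_of_le {t : ℝ} (ht : t ∈ Icc (b.tcLo - b.epsLo / 8) (b.tcLo + b.epsLo / 8))
    (hα : b.alphaLo κ t ≤ 1 / 8) :
    b.spikePiece hcross κ σ 1 t = ((b.band (pt2 (b.chiLo t) (1 / 2 - κ)) : 𝕊 3) : 𝔼 4) := by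
  have hα'' : b.alphaLo κ t ∉ Ioo (1 / 8 : ℝ) 4 := fun hm ↦ by linarith [hm.1]
  by_cases hα7 : |b.alphaLo κ t| < 7
  · rw [b.spikePiece_coreLo hcross h.κ_pos h.κ_le h.eight_le_poleRad σ 1 ht hα7, spikePtLo,
      b.pieceLo_eq_rail hcross hα'', ← railPtLo, b.railPtLo_eq_neckPiece hcross h.κ_pos h.eight_le_poleRad ht hα7,
      b.neckPiece_coreLo ht]
  · have hα' : b.alphaLo κ t ∉ Icc (-1 : ℝ) 6 := fun hm ↦ hα7 (b.abs_alphaLo_lt_of_mem hm)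
    rw [b.spikePiece_eq_neckPiece' h 1 (b.not_mem_spikeSet_of_coreLo ht hα'), b.neckPiece_coreLo ht]

/-- On the closed upper core left of the turn the spiked piece function is the band point
`(χ₂ (-t), 1/2 + κ)`. [folklore] -/
theorem spikePiece_one_coreHi_of_le {t : ℝ} (ht : t ∈ Icc (b.tcHi - b.epsHi / 8) (b.tcHi + b.epsHi / 8))
    (hα : b.alphaHi κ t ≤ 1 / 8) :
    b.spikePiece hcross κ σ 1 t = ((b.band (pt2 (b.chiHi t) (1 / 2 + κ)) : 𝕊 3) : 𝔼 4) := by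
  have hα'' : b.alphaHi κ t ∉ Ioo (1 / 8 : ℝ) 4 := fun hm ↦ by linarith [hm.1]
  by_cases hα7 : |b.alphaHi κ t| < 7
  · rw [b.spikePiece_coreHi hcross h.κ_pos h.κ_le h.eight_le_poleRad σ 1 ht hα7, spikePtHi,
      b.pieceHi_eq_rail hcross hα'', ← railPtHi, b.railPtHi_eq_neckPiece hcross h.κ_pos h.eight_le_poleRad ht hα7,
      b.neckPiece_coreHi ht]
  · have hα' : b.alphaHi κ t ∉ Icc (-1 : ℝ) 6 := fun hm ↦ hα7 (b.abs_alphaHi_lt_of_mem hm)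
    rw [b.spikePiece_eq_neckPiece' h 1 (b.not_mem_spikeSet_of_coreHi ht hα'), b.neckPiece_coreHi ht]

/-- Off the two closed cores the spiked piece function is the necked one. [folklore] -/
theorem spikePiece_one_of_not_core {t : ℝ} (h1 : t ∉ Icc (b.tcLo - b.epsLo / 8) (b.tcLo + b.epsLo / 8))
    (h2 : t ∉ Icc (b.tcHi - b.epsHi / 8) (b.tcHi + b.epsHi / 8)) : b.spikePiece hcross κ σ 1 t = b.neckPiece κ 1 t :=
  b.spikePiece_eq_neckPiece' h 1 (by rintro (⟨hc, -⟩ | ⟨hc, -⟩) <;> [exact h1 hc; exact h2 hc])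

/-! ### Hemispheres: the outer stretches and the left parts of the cores are in the north -/

variable (hA : A.InNorth)
include hA

/-- **Before the lower core the spiked knot is in the open northern hemisphere.** [folklore] -/
theorem spikePiece_one_north_of_lt {t : ℝ} (ht : t ∈ Ico b.alo (b.alo + 1)) (hlt : t < b.tcLo - b.epsLo / 8) :
    ∃ x : 𝕊 3, b.spikePiece hcross κ σ 1 t = (x : 𝔼 4) ∧ 0 < (x : 𝔼 4) (Fin.last 3) := by
  obtain ⟨hw1, hw2, hε⟩ := b.tcLo_window
  have hm := b.marks_lt
  have hcore1 : t ∉ Icc (b.tcLo - b.epsLo / 8) (b.tcLo + b.epsLo / 8) := fun hc ↦ by linarith [hc.1]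
  have hcore2 : t ∉ Icc (b.tcHi - b.epsHi / 8) (b.tcHi + b.epsHi / 8) := fun hc ↦ by
    have := b.coreLo_lt_coreHi; linarith [hc.1]
  rw [b.spikePiece_one_of_not_core h hcore1 hcore2]
  -- `χ₁ t ≤ 1/2 - gapLo < 1/2`
  have hχ : b.chiLo t < 1 / 2 := by
    have h1 : b.chiLo t ≤ b.chiLo (b.tcLo - b.epsLo / 8) := b.monotone_chiLo hlt.le
    have h2 : b.gapLo ≤ 1 / 2 - b.chiLo (b.tcLo - b.epsLo / 8) := min_le_right _ _
    linarith [b.gapLo_pos]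
  by_cases hn : t ∈ b.neckSet
  · rcases hn with hw | hw
    · refine ⟨b.band (b.neckLo κ 1 t), b.neckPiece_of_mem_lower hw, ?_⟩
      have hmem := (b.neckLo_mem h.κ_le_quarter h.κ_pos ⟨zero_le_one, le_rfl⟩ hw).1
      have h0 : b.neckLo κ 1 t 0 < 2⁻¹ := by
        rw [(b.neckLo_window h.κ_le_quarter hw).1]; linarith
      exact b.band_last_pos_of_lt_half hA hcross hmem h0
    · exfalso
      obtain ⟨h3, h4, hε'⟩ := b.tcHi_window
      linarith [hw.1]
  · rw [b.neckPiece_eq_railPiece hn]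
    rcases b.kind_cases t with hk | hk | hk | hk
    · rw [b.railPiece_typeA ht hk, Knot.curve_apply]
      exact ⟨_, rfl, hA _⟩
    · exfalso
      obtain ⟨hε0, hε1, -⟩ := b.epsLo_bounds
      linarith [hk.1]
    · obtain ⟨he, hU, -, -, -, -⟩ := b.railPiece_typeO_lo hk
      rw [he]
      refine ⟨_, rfl, b.band_last_pos_of_lt_half hA hcross hU ?_⟩
      rw [railLo_apply_zero]; exact hχ.trans_eq (by norm_num)
    · exfalso
      obtain ⟨hε0, hε1, -⟩ := b.epsHi_bounds
      linarith [hk.1]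

/-- **After the upper core the spiked knot is in the open northern hemisphere.** [folklore] -/
theorem spikePiece_one_north_of_gt {t : ℝ} (ht : t ∈ Ico b.alo (b.alo + 1)) (hgt : b.tcHi + b.epsHi / 8 < t) :
    ∃ x : 𝕊 3, b.spikePiece hcross κ σ 1 t = (x : 𝔼 4) ∧ 0 < (x : 𝔼 4) (Fin.last 3) := by
  obtain ⟨hw1, hw2, hε'⟩ := b.tcHi_window
  have hm := b.marks_lt
  have hcore2 : t ∉ Icc (b.tcHi - b.epsHi / 8) (b.tcHi + b.epsHi / 8) := fun hc ↦ by linarith [hc.2]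
  have hcore1 : t ∉ Icc (b.tcLo - b.epsLo / 8) (b.tcLo + b.epsLo / 8) := fun hc ↦ by
    have := b.coreLo_lt_coreHi; linarith [hc.2]
  rw [b.spikePiece_one_of_not_core h hcore1 hcore2]
  have hχ : b.chiHi t < 1 / 2 := by
    have h1 : b.chiHi t ≤ b.chiHi (b.tcHi + b.epsHi / 8) := b.antitone_chiHi hgt.le
    have h2 : b.gapHi ≤ 1 / 2 - b.chiHi (b.tcHi + b.epsHi / 8) := min_le_right _ _
    linarith [b.gapHi_pos]
  by_cases hn : t ∈ b.neckSet
  · rcases hn with hw | hw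
    · exfalso
      obtain ⟨h3, h4, hε⟩ := b.tcLo_window
      linarith [hw.2]
    · refine ⟨b.band (b.neckUp κ 1 t), b.neckPiece_of_mem_upper hw, ?_⟩
      have hmem := (b.neckUp_mem h.κ_le_quarter h.κ_pos ⟨zero_le_one, le_rfl⟩ hw).1
      have h0 : b.neckUp κ 1 t 0 < 2⁻¹ := by
        rw [(b.neckUp_window h.κ_le_quarter hw).1]; linarith
      exact b.band_last_pos_of_lt_half hA hcross hmem h0
  · rw [b.neckPiece_eq_railPiece hn]
    rcases b.kind_cases t with hk | hk | hk | hk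
    · rw [b.railPiece_typeA ht hk, Knot.curve_apply]
      exact ⟨_, rfl, hA _⟩
    · exfalso
      obtain ⟨hε0, hε1, -⟩ := b.epsHi_bounds
      linarith [hk.2]
    · exfalso
      obtain ⟨hε0, hε1, -⟩ := b.epsLo_bounds
      linarith [hk.2]
    · obtain ⟨he, hU, -, -, -, -⟩ := b.railPiece_typeO_hi hk
      rw [he]
      refine ⟨_, rfl, b.band_last_pos_of_lt_half hA hcross hU ?_⟩
      rw [railUp_apply_zero]
      exact hχ.trans_eq (by norm_num)

/-- **On the lower core with `α t < 0` the spiked knot is in the open northern hemisphere.**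
[folklore] -/
theorem spikePiece_one_north_of_alphaLo_neg {t : ℝ} (ht : t ∈ Icc (b.tcLo - b.epsLo / 8) (b.tcLo + b.epsLo / 8))
    (hα : b.alphaLo κ t < 0) :
    ∃ x : 𝕊 3, b.spikePiece hcross κ σ 1 t = (x : 𝔼 4) ∧ 0 < (x : 𝔼 4) (Fin.last 3) := by
  refine ⟨_, b.spikePiece_one_coreLo_of_le h ht (by linarith), ?_⟩
  have hχ : b.chiLo t < 1 / 2 := by
    have := b.mul_alphaLo h.κ_pos.ne' t
    nlinarith [h.κ_pos]
  have hmem : (pt2 (b.chiLo t) (1 / 2 - κ) : 𝔼 2) ∈ squareNhd b.δ := by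
    rw [← b.neckLo_core ht]
    have hε := b.epsLo_bounds.1
    exact (b.neckLo_mem h.κ_le_quarter h.κ_pos ⟨zero_le_one, le_rfl⟩ ⟨by linarith [ht.1], by linarith [ht.2]⟩).1
  exact b.band_last_pos_of_lt_half hA hcross hmem (by simpa using hχ)

/-- On the upper core with `α t < 0` the spiked knot is in the open northern hemisphere. [folklore] -/
theorem spikePiece_one_north_of_alphaHi_neg {t : ℝ} (ht : t ∈ Icc (b.tcHi - b.epsHi / 8) (b.tcHi + b.epsHi / 8))
    (hα : b.alphaHi κ t < 0) :
    ∃ x : 𝕊 3, b.spikePiece hcross κ σ 1 t = (x : 𝔼 4) ∧ 0 < (x : 𝔼 4) (Fin.last 3) := by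
  refine ⟨_, b.spikePiece_one_coreHi_of_le h ht (by linarith), ?_⟩
  have hχ : b.chiHi t < 1 / 2 := by
    have := b.mul_alphaHi h.κ_pos.ne' t
    nlinarith [h.κ_pos]
  have hmem : (pt2 (b.chiHi t) (1 / 2 + κ) : 𝔼 2) ∈ squareNhd b.δ := by
    rw [← b.neckUp_core ht]
    have hε := b.epsHi_bounds.1
    exact (b.neckUp_mem h.κ_le_quarter h.κ_pos ⟨zero_le_one, le_rfl⟩ ⟨by linarith [ht.1], by linarith [ht.2]⟩).1
  exact b.band_last_pos_of_lt_half hA hcross hmem (by simpa using hχ)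

omit hA

/-! ### The middle content and the non-flat core content lie in the far southern set -/

/-- **Middle content**: for `s` between the cores, the spiked knot is a point of the far southern
set of threshold `g ≤ min gapLo gapHi`. [folklore] -/
theorem spikePiece_one_mem_farSouth_middle {g : ℝ} (hg : g ≤ min b.gapLo b.gapHi) {s : ℝ}
    (hs : s ∈ Ioo (b.tcLo + b.epsLo / 8) (b.tcHi - b.epsHi / 8)) :
    ∃ x ∈ b.farSouth g, b.spikePiece hcross κ σ 1 s = (x : 𝔼 4) := by
  obtain ⟨hw1, hw2, hε⟩ := b.tcLo_window
  obtain ⟨hw3, hw4, hε'⟩ := b.tcHi_window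
  have hm := b.marks_lt
  have hgl : g ≤ b.gapLo := hg.trans (min_le_left _ _)
  have hgh : g ≤ b.gapHi := hg.trans (min_le_right _ _)
  have hcore1 : s ∉ Icc (b.tcLo - b.epsLo / 8) (b.tcLo + b.epsLo / 8) := fun hc ↦ by linarith [hc.2, hs.1]
  have hcore2 : s ∉ Icc (b.tcHi - b.epsHi / 8) (b.tcHi + b.epsHi / 8) := fun hc ↦ by linarith [hc.1, hs.2]
  rw [b.spikePiece_one_of_not_core h hcore1 hcore2]
  have hχ1 : 1 / 2 + b.gapLo ≤ b.chiLo s := by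
    have h1 : b.chiLo (b.tcLo + b.epsLo / 8) ≤ b.chiLo s := b.monotone_chiLo hs.1.le
    have h2 : b.gapLo ≤ b.chiLo (b.tcLo + b.epsLo / 8) - 1 / 2 := min_le_left _ _
    linarith
  have hχ2 : 1 / 2 + b.gapHi ≤ b.chiHi s := by
    have h1 : b.chiHi (b.tcHi - b.epsHi / 8) ≤ b.chiHi s := b.antitone_chiHi hs.2.le
    have h2 : b.gapHi ≤ b.chiHi (b.tcHi - b.epsHi / 8) - 1 / 2 := min_le_left _ _
    linarith
  by_cases hn : s ∈ b.neckSet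
  · rcases hn with hw | hw
    · refine ⟨b.band (b.neckLo κ 1 s), Or.inl ⟨_, ?_, rfl⟩, b.neckPiece_of_mem_lower hw⟩
      obtain ⟨h0, h1, h01⟩ := b.neckLo_window h.κ_le_quarter hw
      exact ⟨⟨by rw [h0]; linarith, h01.2⟩, ⟨by linarith [h1.1], by linarith [h1.2, h.κ_pos]⟩⟩
    · refine ⟨b.band (b.neckUp κ 1 s), Or.inl ⟨_, ?_, rfl⟩, b.neckPiece_of_mem_upper hw⟩
      obtain ⟨h0, h1, h01⟩ := b.neckUp_window h.κ_le_quarter hw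
      exact ⟨⟨by rw [h0]; linarith, h01.2⟩, ⟨by linarith [h1.1, h.κ_pos], by linarith [h1.2]⟩⟩
  · rw [b.neckPiece_eq_railPiece hn]
    have hn' : s ∉ Icc (b.tcLo - b.epsLo / 2) (b.tcLo + b.epsLo / 2) := fun hw ↦ hn (Or.inl hw)
    have hn'' : s ∉ Icc (b.tcHi - b.epsHi / 2) (b.tcHi + b.epsHi / 2) := fun hw ↦ hn (Or.inr hw)
    have hs1 : b.tcLo + b.epsLo / 2 < s := by
      by_contra hle; exact hn' ⟨by linarith [hs.1], not_lt.1 hle⟩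
    have hs2 : s < b.tcHi - b.epsHi / 2 := by
      by_contra hle; exact hn'' ⟨not_lt.1 hle, by linarith [hs.2]⟩
    rcases b.kind_cases s with hk | hk | hk | hk
    · exfalso
      rcases hk with hk | hk <;> linarith
    · rw [b.railPiece_typeB hk, Knot.curve_apply]
      exact ⟨_, Or.inr ⟨_, rfl⟩, rfl⟩
    · obtain ⟨he, hU, h0, h1, -, -⟩ := b.railPiece_typeO_lo hk
      rw [he]
      refine ⟨_, Or.inl ⟨_, ⟨⟨?_, h0.2.le⟩, ⟨?_, by linarith⟩⟩, rfl⟩, rfl⟩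
      · exact (show (1 : ℝ) / 2 + g ≤ b.chiLo s by linarith)
      · exact (b.railLo_mem (t := s) ⟨by linarith [hk.1], by linarith [hk.2]⟩).2.1.le
    · obtain ⟨he, hU, h0, h1, -, -⟩ := b.railPiece_typeO_hi hk
      rw [he]
      refine ⟨_, Or.inl ⟨_, ⟨⟨?_, h0.2.le⟩, ⟨by linarith, ?_⟩⟩, rfl⟩, rfl⟩
      · exact (show (1 : ℝ) / 2 + g ≤ b.chiHi s by linarith)
      · exact (b.railUp_mem (t := s) ⟨by linarith [hk.1], by linarith [hk.2]⟩).2.2.le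

/-- **Non-flat lower-core content** (`‖q_s‖ ≥ r`, `α s ≥ 3/8`) lies in the far southern set of
threshold `g ≤ r/2`. [folklore] -/
theorem spikePiece_one_mem_farSouth_coreLo {g : ℝ} (hg : g ≤ r / 2) {s : ℝ}
    (hs : s ∈ Icc (b.tcLo - b.epsLo / 8) (b.tcLo + b.epsLo / 8)) (hα : 3 / 8 ≤ b.alphaLo κ s)
    (hq : r ≤ κ * (|b.alphaLo κ s| + 1)) :
    ∃ x ∈ b.farSouth g, b.spikePiece hcross κ σ 1 s = (x : 𝔼 4) := by
  have hκ := h.κ_pos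
  rw [abs_of_nonneg (by linarith)] at hq
  -- `α s` is large: `κ α ≥ r - κ ≥ r/2`
  have hbig : r - κ ≤ κ * b.alphaLo κ s := by linarith
  have h8 := h.eight_lt_r
  have hα7 : ¬ |b.alphaLo κ s| < 7 := by
    intro hlt
    have := (abs_lt.1 hlt).2
    nlinarith
  have hα' : b.alphaLo κ s ∉ Icc (-1 : ℝ) 6 := fun hm ↦ hα7 (b.abs_alphaLo_lt_of_mem hm)
  rw [b.spikePiece_eq_neckPiece' h 1 (b.not_mem_spikeSet_of_coreLo hs hα'), b.neckPiece_coreLo hs]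
  refine ⟨_, Or.inl ⟨_, ⟨⟨?_, ?_⟩, ?_⟩, rfl⟩, rfl⟩
  · show 1 / 2 + g ≤ (pt2 (b.chiLo s) (1 / 2 - κ) : 𝔼 2) 0
    rw [pt2_apply_zero]
    have := b.mul_alphaLo hκ.ne' s
    linarith
  · show (pt2 (b.chiLo s) (1 / 2 - κ) : 𝔼 2) 0 ≤ 1
    rw [pt2_apply_zero]
    exact (smoothStep_mem_Icc _ _ _).2
  · show (pt2 (b.chiLo s) (1 / 2 - κ) : 𝔼 2) 1 ∈ Icc (10⁻¹ : ℝ) (9 / 10)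
    rw [pt2_apply_one]
    have := h.κ_le_quarter
    constructor <;> linarith

/-- Non-flat upper-core content lies in the far southern set of threshold `g ≤ r/2`. [folklore] -/
theorem spikePiece_one_mem_farSouth_coreHi {g : ℝ} (hg : g ≤ r / 2) {s : ℝ}
    (hs : s ∈ Icc (b.tcHi - b.epsHi / 8) (b.tcHi + b.epsHi / 8)) (hα : 3 / 8 ≤ b.alphaHi κ s)
    (hq : r ≤ κ * (|b.alphaHi κ s| + 1)) :
    ∃ x ∈ b.farSouth g, b.spikePiece hcross κ σ 1 s = (x : 𝔼 4) := by
  have hκ := h.κ_pos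
  rw [abs_of_nonneg (by linarith)] at hq
  have hbig : r - κ ≤ κ * b.alphaHi κ s := by linarith
  have h8 := h.eight_lt_r
  have hα7 : ¬ |b.alphaHi κ s| < 7 := by
    intro hlt
    have := (abs_lt.1 hlt).2
    nlinarith
  have hα' : b.alphaHi κ s ∉ Icc (-1 : ℝ) 6 := fun hm ↦ hα7 (b.abs_alphaHi_lt_of_mem hm)
  rw [b.spikePiece_eq_neckPiece' h 1 (b.not_mem_spikeSet_of_coreHi hs hα'), b.neckPiece_coreHi hs]
  refine ⟨_, Or.inl ⟨_, ⟨⟨?_, ?_⟩, ?_⟩, rfl⟩, rfl⟩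
  · show 1 / 2 + g ≤ (pt2 (b.chiHi s) (1 / 2 + κ) : 𝔼 2) 0
    rw [pt2_apply_zero]
    have := b.mul_alphaHi hκ.ne' s
    linarith
  · show (pt2 (b.chiHi s) (1 / 2 + κ) : 𝔼 2) 0 ≤ 1
    rw [pt2_apply_zero]
    exact (smoothStep_mem_Icc _ _ _).2
  · show (pt2 (b.chiHi s) (1 / 2 + κ) : 𝔼 2) 1 ∈ Icc (10⁻¹ : ℝ) (9 / 10)
    rw [pt2_apply_one]
    have := h.κ_le_quarter
    constructor <;> linarith

end Scale

/-! ### Blow-up coordinates of chords -/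

/-- **Blow-up coordinates of a chord point**: `blowUp (o + μ (Y - o)) = (1 - μ) (1, 0, σ) + μ blowUp Y`
for `o = oS κ σ` (the blow-up map is affine). [folklore] -/
theorem blowUp_chord {κ : ℝ} (hκ : κ ≠ 0) (σ μ : ℝ) (Y : 𝔼 3) :
    b.blowUp hcross κ (b.oS hcross κ σ + μ • (Y - b.oS hcross κ σ)) =
      (1 - μ) • pt3 1 0 σ + μ • b.blowUp hcross κ Y := by
  have e : b.oS hcross κ σ + μ • (Y - b.oS hcross κ σ) =
      b.blowDown hcross κ ((1 - μ) • pt3 1 0 σ + μ • b.blowUp hcross κ Y) := by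
    rw [oS]
    conv_lhs => rw [← b.blowDown_blowUp hcross hκ Y]
    simp only [blowDown, map_add, map_smul, smul_add]
    module
  rw [e, b.blowUp_blowDown hcross hκ]

/-- First blow-up coordinate of a chord point: `(1 - μ) + μ (blowUp Y)₀`. [folklore] -/
theorem blowUp_chord_zero {κ : ℝ} (hκ : κ ≠ 0) (σ μ : ℝ) (Y : 𝔼 3) :
    b.blowUp hcross κ (b.oS hcross κ σ + μ • (Y - b.oS hcross κ σ)) 0 = (1 - μ) + μ * b.blowUp hcross κ Y 0 := by
  rw [b.blowUp_chord hcross hκ]; simp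

/-- **A chord from a point with first blow-up coordinate `≥ 3/8` has first blow-up coordinate
`≥ 3/8`.** [folklore] -/
theorem le_blowUp_chord_zero {κ : ℝ} (hκ : κ ≠ 0) (σ : ℝ) {μ : ℝ} (hμ : μ ∈ Icc (0 : ℝ) 1) {Y : 𝔼 3}
    (hY : 3 / 8 ≤ b.blowUp hcross κ Y 0) : 3 / 8 ≤ b.blowUp hcross κ (b.oS hcross κ σ + μ • (Y - b.oS hcross κ σ)) 0 := by
  rw [b.blowUp_chord_zero hcross hκ]; nlinarith [hμ.1, hμ.2]

/-- **The blow-up norm of a chord point** is at most `max 2 ‖blowUp Y‖` (for `|σ| ≤ 1`). [folklore] -/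
theorem norm_blowUp_chord_le {κ : ℝ} (hκ : κ ≠ 0) {σ : ℝ} (hσ : |σ| ≤ 1) {μ : ℝ} (hμ : μ ∈ Icc (0 : ℝ) 1) (Y : 𝔼 3) :
    ‖b.blowUp hcross κ (b.oS hcross κ σ + μ • (Y - b.oS hcross κ σ))‖ ≤ max 2 ‖b.blowUp hcross κ Y‖ := by
  rw [b.blowUp_chord hcross hκ]
  have h1 : ‖(pt3 1 0 σ : 𝔼 3)‖ ≤ 2 := (norm_pt3_le _ _ _).trans (by simp; linarith)
  calc ‖(1 - μ) • (pt3 1 0 σ : 𝔼 3) + μ • b.blowUp hcross κ Y‖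
      ≤ (1 - μ) * ‖(pt3 1 0 σ : 𝔼 3)‖ + μ * ‖b.blowUp hcross κ Y‖ := by
        refine (norm_add_le _ _).trans ?_
        rw [norm_smul, norm_smul, Real.norm_eq_abs, Real.norm_eq_abs, abs_of_nonneg (by linarith [hμ.2]), abs_of_nonneg hμ.1]
    _ ≤ (1 - μ) * max 2 ‖b.blowUp hcross κ Y‖ + μ * max 2 ‖b.blowUp hcross κ Y‖ := by
        gcongr
        · linarith [hμ.2]
        · exact h1.trans (le_max_left _ _)
        · exact hμ.1
        · exact le_max_right _ _
    _ = _ := by ring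

/-! ### The four separation mechanisms -/

/-- **(P1) First coordinate**: a chord from `Y` with `(blowUp Y)₀ ≥ 3/8` never reaches a point `y`
with `(blowUp y)₀ < 3/8`. [folklore] -/
theorem chord_ne_of_blowUp_zero {κ : ℝ} (hκ : κ ≠ 0) (σ : ℝ) {μ : ℝ} (hμ : μ ∈ Icc (0 : ℝ) 1) {Y y : 𝔼 3}
    (hY : 3 / 8 ≤ b.blowUp hcross κ Y 0) (hy : b.blowUp hcross κ y 0 < 3 / 8) :
    b.oS hcross κ σ + μ • (Y - b.oS hcross κ σ) ≠ y := by
  intro he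
  have := b.le_blowUp_chord_zero hcross hκ σ hμ hY
  rw [he] at this
  linarith

/-- **(P3) Hemispheres**: a chord between points of positive depth, read back on the sphere, is
not a point of the closed northern hemisphere. [folklore] -/
theorem psiN_symm_chord_ne_of_north {o Y : 𝔼 3} (ho : 0 < depth o) (hY : 0 < depth Y) {μ : ℝ} (hμ : μ ∈ Icc (0 : ℝ) 1)
    {x : 𝕊 3} (hx : 0 ≤ (x : 𝔼 4) (Fin.last 3)) : psiN.symm (o + μ • (Y - o)) ≠ x :=
  psiN_symm_ne_of_depth_pos (depth_chord_pos ho hY hμ) hx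

/-- **(P4) Depth**: a chord between points of depth `≥ d₀` never reaches a point of depth `< d₀`.
[folklore] -/
theorem chord_ne_of_depth {o Y y : 𝔼 3} {d₀ : ℝ} (ho : d₀ ≤ depth o) (hY : d₀ ≤ depth Y) {μ : ℝ} (hμ : μ ∈ Icc (0 : ℝ) 1)
    (hy : depth y < d₀) : o + μ • (Y - o) ≠ y := by
  intro he
  have := min_depth_le_depth_chord o Y hμ
  rw [he] at this
  have : d₀ ≤ min (depth o) (depth Y) := le_min ho hY
  linarith

/-! ### Estimates for flat walls and flat content -/

section Flat

variable {hcross} {ε r κ : ℝ} (hf : b.IsFlat hcross ε r) (hκ : 0 < κ)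
include hf hκ

omit hf hκ in omit b in
/-- A convex combination is at most the maximum. [folklore] -/
theorem convexComb_le_max {w x y : ℝ} (hw : w ∈ Icc (0 : ℝ) 1) : (1 - w) * x + w * y ≤ max x y := by
  have h1 := le_max_left x y; have h2 := le_max_right x y; nlinarith [hw.1, hw.2]

omit hf hκ in omit b in
/-- A convex combination is at least the minimum. [folklore] -/
theorem min_le_convexComb {w x y : ℝ} (hw : w ∈ Icc (0 : ℝ) 1) : min x y ≤ (1 - w) * x + w * y := by
  have h1 := min_le_left x y; have h2 := min_le_right x y; nlinarith [hw.1, hw.2]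

/-- **Flat lower wall, first coordinate**: for `α < 3/8` (with `κ (|α| + 1) < r`, `ε ≤ 1/16`) the
final lower piece has first blow-up coordinate `< 3/8`. [folklore] -/
theorem blowUp_pieceLo_one_zero_lt (hε : ε ≤ 1 / 16) {σ α : ℝ} (hα : α < 3 / 8) (hsc : κ * (|α| + 1) < r) :
    b.blowUp hcross κ (b.pieceLo hcross κ σ 1 α) 0 < 3 / 8 := by
  rw [b.blowUp_pieceLo_zero hcross hκ.ne', one_mul]
  have hR := (b.blowUp_railLoPsi_coord hf hκ hsc).1
  have hR' := (abs_le.1 hR).2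
  have hβ := spikeBump_mem_Icc α
  by_cases h14 : 1 / 4 ≤ α
  · rw [spikeBump_eq_one ⟨h14, by linarith⟩]; linarith
  · push Not at h14
    have hεn := hf.eps_nonneg
    rcases le_or_gt 0 α with h0 | h0
    · -- `0 ≤ α < 1/4`: the rail coordinate is `≤ α + ε (α + 1) < 3/8`
      rw [abs_of_nonneg h0] at hR'
      have h1 : b.blowUp hcross κ (b.railLoPsi κ α) 0 < 3 / 8 := by nlinarith
      calc _ ≤ max (b.blowUp hcross κ (b.railLoPsi κ α) 0) α := convexComb_le_max hβ
        _ < 3 / 8 := max_lt h1 (by linarith)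
    · rw [abs_of_neg h0] at hR'
      have h1 : b.blowUp hcross κ (b.railLoPsi κ α) 0 < 3 / 8 := by nlinarith
      calc _ ≤ max (b.blowUp hcross κ (b.railLoPsi κ α) 0) α := convexComb_le_max hβ
        _ < 3 / 8 := max_lt h1 (by linarith)

/-- Flat upper wall, first coordinate. [folklore] -/
theorem blowUp_pieceHi_one_zero_lt (hε : ε ≤ 1 / 16) {σ α : ℝ} (hα : α < 3 / 8) (hsc : κ * (|α| + 1) < r) :
    b.blowUp hcross κ (b.pieceHi hcross κ σ 1 α) 0 < 3 / 8 := by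
  rw [b.blowUp_pieceHi_zero hcross hκ.ne', one_mul]
  have hR := (b.blowUp_railHiPsi_coord hf hκ hsc).1
  have hR' := (abs_le.1 hR).2
  have hβ := spikeBump_mem_Icc α
  by_cases h14 : 1 / 4 ≤ α
  · rw [spikeBump_eq_one ⟨h14, by linarith⟩]; linarith
  · push Not at h14
    have hεn := hf.eps_nonneg
    rcases le_or_gt 0 α with h0 | h0
    · rw [abs_of_nonneg h0] at hR'
      have h1 : b.blowUp hcross κ (b.railHiPsi κ α) 0 < 3 / 8 := by nlinarith
      calc _ ≤ max (b.blowUp hcross κ (b.railHiPsi κ α) 0) α := convexComb_le_max hβ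
        _ < 3 / 8 := max_lt h1 (by linarith)
    · rw [abs_of_neg h0] at hR'
      have h1 : b.blowUp hcross κ (b.railHiPsi κ α) 0 < 3 / 8 := by nlinarith
      calc _ ≤ max (b.blowUp hcross κ (b.railHiPsi κ α) 0) α := convexComb_le_max hβ
        _ < 3 / 8 := max_lt h1 (by linarith)

/-- **Flat lower content, first coordinate**: for `α ≥ 3/8` (with `κ (|α| + 1) < r`, `ε ≤ 1/16`)
the final lower piece has first blow-up coordinate `≥ 3/8`. [folklore] -/
theorem le_blowUp_pieceLo_one_zero (hε : ε ≤ 1 / 16) {σ α : ℝ} (hα : 3 / 8 ≤ α) (hsc : κ * (|α| + 1) < r) :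
    3 / 8 ≤ b.blowUp hcross κ (b.pieceLo hcross κ σ 1 α) 0 := by
  by_cases h3 : α ≤ 3
  · rw [b.blowUp_pieceLo_one_of_mem hcross hκ.ne' ⟨by linarith, h3⟩, modelLo_apply_zero]; exact hα
  · push Not at h3
    rw [b.blowUp_pieceLo_zero hcross hκ.ne', one_mul]
    have hR := (b.blowUp_railLoPsi_coord hf hκ hsc).1
    have hR' := (abs_le.1 hR).1
    rw [abs_of_nonneg (by linarith)] at hR'
    have hεn := hf.eps_nonneg
    have h1 : 3 / 8 ≤ b.blowUp hcross κ (b.railLoPsi κ α) 0 := by nlinarith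
    calc (3 : ℝ) / 8 ≤ min (b.blowUp hcross κ (b.railLoPsi κ α) 0) α := le_min h1 (by linarith)
      _ ≤ _ := min_le_convexComb (spikeBump_mem_Icc α)

/-- Flat upper content, first coordinate. [folklore] -/
theorem le_blowUp_pieceHi_one_zero (hε : ε ≤ 1 / 16) {σ α : ℝ} (hα : 3 / 8 ≤ α) (hsc : κ * (|α| + 1) < r) :
    3 / 8 ≤ b.blowUp hcross κ (b.pieceHi hcross κ σ 1 α) 0 := by
  by_cases h3 : α ≤ 3
  · rw [b.blowUp_pieceHi_one_of_mem hcross hκ.ne' ⟨by linarith, h3⟩, modelHi_apply_zero]; exact hα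
  · push Not at h3
    rw [b.blowUp_pieceHi_zero hcross hκ.ne', one_mul]
    have hR := (b.blowUp_railHiPsi_coord hf hκ hsc).1
    have hR' := (abs_le.1 hR).1
    rw [abs_of_nonneg (by linarith)] at hR'
    have hεn := hf.eps_nonneg
    have h1 : 3 / 8 ≤ b.blowUp hcross κ (b.railHiPsi κ α) 0 := by nlinarith
    calc (3 : ℝ) / 8 ≤ min (b.blowUp hcross κ (b.railHiPsi κ α) 0) α := le_min h1 (by linarith)
      _ ≤ _ := min_le_convexComb (spikeBump_mem_Icc α)

omit hf hκ in
/-- The depth covector is affine along convex combinations. [folklore] -/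
theorem rho_convexComb (w : ℝ) (X Y : 𝔼 3) :
    b.rho hcross ((1 - w) • X + w • Y) = (1 - w) * b.rho hcross X + w * b.rho hcross Y := by
  simp only [rho, map_add, map_smul, inner_add_right, inner_smul_right]; ring

variable (hB : B.InSouth)
include hB

/-- **Flat lower wall on the southern side, depth**: for `0 ≤ α < 3/8` (flat, `ε ≤ 1/16`, sign
`σ = depthSign`) the final lower piece has depth at most `κ m₀ (3/8 + 11 ε / 8)`. [folklore] -/
theorem depth_pieceLo_one_le (hε : ε ≤ 1 / 16) {α : ℝ} (hα0 : 0 ≤ α) (hα : α < 3 / 8) (hsc : κ * (|α| + 1) < r) :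
    depth (b.pieceLo hcross κ b.depthSign 1 α) ≤ κ * (b.mZero * (3 / 8 + 11 * ε / 8)) := by
  set W := b.blowUp hcross κ (b.pieceLo hcross κ b.depthSign 1 α)
  have eW : b.pieceLo hcross κ b.depthSign 1 α = b.blowDown hcross κ W := (b.blowDown_blowUp hcross hκ.ne' _).symm
  rw [eW]
  refine (b.depth_blowDown_le hcross κ W).trans (mul_le_mul_of_nonneg_left ?_ hκ.le)
  -- `ρ(W) = (1 - β) ρ(R) + β ρ(model)`
  have hWeq : W = (1 - spikeBump α) • b.blowUp hcross κ (b.railLoPsi κ α) + spikeBump α • modelLo b.depthSign α := by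
    simp only [W, b.blowUp_pieceLo hcross hκ.ne', one_mul]
  rw [hWeq, rho_convexComb]
  have hβ := spikeBump_mem_Icc α
  have hρ1 := b.rhoOne_nonneg hcross hB
  have hm : b.mZero = b.rhoOne + |b.rhoThree| := rfl
  have hεn := hf.eps_nonneg
  -- the model term
  have hmodel : b.rho hcross (modelLo b.depthSign α) ≤ 3 / 8 * b.rhoOne + |b.rhoThree| / 6 := by
    have hs : spikeProfile α = (α - 1 / 4) / (3 / 4) := spikeProfile_of_le (by linarith)
    rw [modelLo, rho_pt3, ← mul_assoc, mul_comm b.rhoThree b.depthSign, depthSign_mul_rhoThree, hs]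
    have h16 : (α - 1 / 4) / (3 / 4) ≤ 1 / 6 := by rw [div_le_iff₀ (by norm_num)]; linarith
    nlinarith [abs_nonneg b.rhoThree]
  -- the rail term
  have hrail : b.rho hcross (b.blowUp hcross κ (b.railLoPsi κ α)) ≤ 3 / 8 * b.rhoOne + b.mZero * (11 * ε / 8) := by
    have hd := b.abs_rho_sub_le hcross (b.blowUp hcross κ (b.railLoPsi κ α)) (pt3 α (-1) 0)
    have hn := b.norm_blowUp_railLoPsi_sub_le hf hκ hsc
    rw [rho_pt3, mul_zero, add_zero, abs_of_nonneg hρ1, ← hm] at hd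
    have h1 := (abs_le.1 hd).2
    rw [abs_of_nonneg hα0] at hn hsc
    have hmz : 0 ≤ b.mZero := by rw [hm]; positivity
    have h2 : b.mZero * ‖b.blowUp hcross κ (b.railLoPsi κ α) - pt3 α (-1) 0‖ ≤ b.mZero * (ε * (α + 1)) :=
      mul_le_mul_of_nonneg_left hn hmz
    nlinarith [mul_nonneg hmz hεn]
  have hcomb : (1 - spikeBump α) * b.rho hcross (b.blowUp hcross κ (b.railLoPsi κ α)) +
      spikeBump α * b.rho hcross (modelLo b.depthSign α) ≤
      max (3 / 8 * b.rhoOne + b.mZero * (11 * ε / 8)) (3 / 8 * b.rhoOne + |b.rhoThree| / 6) := by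
    calc _ ≤ max (b.rho hcross (b.blowUp hcross κ (b.railLoPsi κ α))) (b.rho hcross (modelLo b.depthSign α)) := convexComb_le_max hβ
      _ ≤ _ := max_le_max hrail hmodel
  have hmax : max (3 / 8 * b.rhoOne + b.mZero * (11 * ε / 8)) (3 / 8 * b.rhoOne + |b.rhoThree| / 6) ≤
      b.mZero * (3 / 8 + 11 * ε / 8) := by
    have hmz : 0 ≤ b.mZero := by rw [hm]; positivity
    refine max_le ?_ ?_ <;> rw [hm] <;> nlinarith [abs_nonneg b.rhoThree, mul_nonneg hmz hεn]
  exact hcomb.trans hmax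

/-- Flat upper wall on the southern side, depth. [folklore] -/
theorem depth_pieceHi_one_le (hε : ε ≤ 1 / 16) {α : ℝ} (hα0 : 0 ≤ α) (hα : α < 3 / 8) (hsc : κ * (|α| + 1) < r) :
    depth (b.pieceHi hcross κ b.depthSign 1 α) ≤ κ * (b.mZero * (3 / 8 + 11 * ε / 8)) := by
  set W := b.blowUp hcross κ (b.pieceHi hcross κ b.depthSign 1 α)
  have eW : b.pieceHi hcross κ b.depthSign 1 α = b.blowDown hcross κ W := (b.blowDown_blowUp hcross hκ.ne' _).symm
  rw [eW]
  refine (b.depth_blowDown_le hcross κ W).trans (mul_le_mul_of_nonneg_left ?_ hκ.le)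
  have hWeq : W = (1 - spikeBump α) • b.blowUp hcross κ (b.railHiPsi κ α) + spikeBump α • modelHi b.depthSign α := by
    simp only [W, b.blowUp_pieceHi hcross hκ.ne', one_mul]
  rw [hWeq, rho_convexComb]
  have hβ := spikeBump_mem_Icc α
  have hρ1 := b.rhoOne_nonneg hcross hB
  have hm : b.mZero = b.rhoOne + |b.rhoThree| := rfl
  have hεn := hf.eps_nonneg
  have hmodel : b.rho hcross (modelHi b.depthSign α) ≤ 3 / 8 * b.rhoOne + |b.rhoThree| / 6 := by
    have hs : spikeProfile α = (α - 1 / 4) / (3 / 4) := spikeProfile_of_le (by linarith)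
    rw [modelHi, rho_pt3, ← mul_assoc, mul_comm b.rhoThree b.depthSign, depthSign_mul_rhoThree, hs]
    have h16 : (α - 1 / 4) / (3 / 4) ≤ 1 / 6 := by rw [div_le_iff₀ (by norm_num)]; linarith
    nlinarith [abs_nonneg b.rhoThree]
  have hrail : b.rho hcross (b.blowUp hcross κ (b.railHiPsi κ α)) ≤ 3 / 8 * b.rhoOne + b.mZero * (11 * ε / 8) := by
    have hd := b.abs_rho_sub_le hcross (b.blowUp hcross κ (b.railHiPsi κ α)) (pt3 α 1 0)
    have hn := b.norm_blowUp_railHiPsi_sub_le hf hκ hsc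
    rw [rho_pt3, mul_zero, add_zero, abs_of_nonneg hρ1, ← hm] at hd
    have h1 := (abs_le.1 hd).2
    rw [abs_of_nonneg hα0] at hn hsc
    have hmz : 0 ≤ b.mZero := by rw [hm]; positivity
    have h2 : b.mZero * ‖b.blowUp hcross κ (b.railHiPsi κ α) - pt3 α 1 0‖ ≤ b.mZero * (ε * (α + 1)) :=
      mul_le_mul_of_nonneg_left hn hmz
    nlinarith [mul_nonneg hmz hεn]
  have hcomb : (1 - spikeBump α) * b.rho hcross (b.blowUp hcross κ (b.railHiPsi κ α)) +
      spikeBump α * b.rho hcross (modelHi b.depthSign α) ≤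
      max (3 / 8 * b.rhoOne + b.mZero * (11 * ε / 8)) (3 / 8 * b.rhoOne + |b.rhoThree| / 6) := by
    calc _ ≤ max (b.rho hcross (b.blowUp hcross κ (b.railHiPsi κ α))) (b.rho hcross (modelHi b.depthSign α)) := convexComb_le_max hβ
      _ ≤ _ := max_le_max hrail hmodel
  have hmax : max (3 / 8 * b.rhoOne + b.mZero * (11 * ε / 8)) (3 / 8 * b.rhoOne + |b.rhoThree| / 6) ≤
      b.mZero * (3 / 8 + 11 * ε / 8) := by
    have hmz : 0 ≤ b.mZero := by rw [hm]; positivity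
    refine max_le ?_ ?_ <;> rw [hm] <;> nlinarith [abs_nonneg b.rhoThree, mul_nonneg hmz hεn]
  exact hcomb.trans hmax

end Flat

/-! ### The scale hypotheses of the cone condition -/

/-- **The cone scale hypotheses**: the spike scale hypotheses at the sign `σ = depthSign`, with
`ε ≤ 1/16`, the centre depth condition `κ ‖frame (1, 0, σ)‖² ≤ m₀/2`, and a far depth `d` with
`κ m₀ ≤ d` bounding below the depth of the far southern set of threshold `min (r/2) (min gapLo gapHi)`.
[folklore] -/
structure ConeScale (ε r A' κ : ℝ) : Prop where
  spike : b.SpikeScale hcross b.depthSign ε r A' κ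
  eps_le : ε ≤ 1 / 16
  centre_small : κ * ‖b.frame hcross (pt3 1 0 b.depthSign)‖ ^ 2 ≤ b.mZero / 2
  far_depth : ∃ d : ℝ, (∀ x ∈ b.farSouth (min (r / 2) (min b.gapLo b.gapHi)), d ≤ depth (psiN x)) ∧ κ * b.mZero ≤ d
  far_half : ∃ m ρ₀ : ℝ, (∀ z ∈ b.farSet (min (r / 2) (min b.gapLo b.gapHi)), m ≤ ‖z - ((b.crossPt : 𝕊 3) : 𝔼 4)‖) ∧
      (∀ y : 𝔼 3, ‖y - b.pZero‖ < ρ₀ → ‖((psiN.symm y : 𝕊 3) : 𝔼 4) - ((b.crossPt : 𝕊 3) : 𝔼 4)‖ < m) ∧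
      9 * κ * ‖((b.frame hcross : (𝔼 3) ≃L[ℝ] 𝔼 3) : (𝔼 3) →L[ℝ] 𝔼 3)‖ < ρ₀

/-! ### The knot points and their chart values -/

section Cone

variable {hcross} {ε r A' κ : ℝ} (h : b.ConeScale hcross ε r A' κ)
include h

/-- The spiked piece function at `u = 1` is a unit vector everywhere. [folklore] -/
theorem norm_spikePiece_one (s : ℝ) : ‖b.spikePiece hcross κ b.depthSign 1 s‖ = 1 := by
  by_cases hs : s ∈ b.spikeSet κ
  · exact b.norm_spikePiece hcross h.spike.κ_pos h.spike.κ_le h.spike.eight_le_poleRad _ 1 hs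
  · rw [b.spikePiece_eq_neckPiece' h.spike 1 hs]; exact b.norm_neckPiece κ 1 s

/-- **The knot point** of parameter `s`: the spiked piece function at `u = 1` as a point of `𝕊 3`.
[folklore] -/
def knotPt (s : ℝ) : 𝕊 3 :=
  ⟨b.spikePiece hcross κ b.depthSign 1 s, by rw [mem_sphere_zero_iff_norm, b.norm_spikePiece_one h]⟩

/-- The knot point as a vector. [folklore] -/
@[simp] theorem coe_knotPt (s : ℝ) : ((b.knotPt h s : 𝕊 3) : 𝔼 4) = b.spikePiece hcross κ b.depthSign 1 s := rfl

/-- **The chart value** of the knot point. [folklore] -/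
def Ypt (s : ℝ) : 𝔼 3 := psiN (b.knotPt h s)

/-- If the spiked piece function is `ψ⁻¹ y` then the knot point is `ψ⁻¹ y` and its chart value is `y`.
[folklore] -/
theorem Ypt_eq_of_eq {s : ℝ} {y : 𝔼 3} (he : b.spikePiece hcross κ b.depthSign 1 s = ((psiN.symm y : 𝕊 3) : 𝔼 4)) :
    b.knotPt h s = psiN.symm y ∧ b.Ypt h s = y := by
  have h1 : b.knotPt h s = psiN.symm y := Subtype.ext he
  exact ⟨h1, by rw [Ypt, h1, psiN_apply_psiN_symm]⟩

/-- If the knot point is not the north pole, it is `ψ⁻¹` of its chart value. [folklore] -/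
theorem psiN_symm_Ypt {s : ℝ} (hne : b.knotPt h s ≠ northPole) : psiN.symm (b.Ypt h s) = b.knotPt h s :=
  psiN_symm_apply_psiN hne

/-- The threshold of the far southern set used by the cone scale. [folklore] -/
theorem farThreshold_pos : 0 < min (r / 2) (min b.gapLo b.gapHi) :=
  lt_min (by linarith [h.spike.flat.r_pos]) (lt_min b.gapLo_pos b.gapHi_pos)

/-- **Far-regime separation at the half threshold**: a chart point within `9κ‖frame‖` of `pZero`
never maps under `ψ⁻¹` into the far set of radius `min (r/2) (min gapLo gapHi)`. [folklore] -/
theorem psiN_symm_not_mem_farSet_half {y : 𝔼 3}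
    (hy : ‖y - b.pZero‖ ≤ 9 * κ * ‖((b.frame hcross : (𝔼 3) ≃L[ℝ] 𝔼 3) : (𝔼 3) →L[ℝ] 𝔼 3)‖) :
    ((psiN.symm y : 𝕊 3) : 𝔼 4) ∉ b.farSet (min (r / 2) (min b.gapLo b.gapHi)) := by
  obtain ⟨m, ρ₀, hm, hρ₀, hκρ⟩ := h.far_half
  intro hmem
  have h1 := hm _ hmem
  have h2 := hρ₀ y (lt_of_le_of_lt hy hκρ)
  linarith

/-! ### Classification of content and wall parameters -/

/-- **Content parameters**: flat lower core (`α ≥ 3/8`, chart value the final lower piece), flat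
upper core, or a point of the far southern set. [folklore] -/
theorem content_cases {s : ℝ} (hs : s ∈ b.contentSet h.spike.κ_pos h.spike.seven_le_gapLo h.spike.seven_le_gapHi) :
    (s ∈ Icc (b.tcLo - b.epsLo / 8) (b.tcLo + b.epsLo / 8) ∧ 3 / 8 ≤ b.alphaLo κ s ∧
        κ * (|b.alphaLo κ s| + 1) < r ∧ b.knotPt h s = psiN.symm (b.pieceLo hcross κ b.depthSign 1 (b.alphaLo κ s)) ∧
        b.Ypt h s = b.pieceLo hcross κ b.depthSign 1 (b.alphaLo κ s)) ∨
      (s ∈ Icc (b.tcHi - b.epsHi / 8) (b.tcHi + b.epsHi / 8) ∧ 3 / 8 ≤ b.alphaHi κ s ∧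
        κ * (|b.alphaHi κ s| + 1) < r ∧ b.knotPt h s = psiN.symm (b.pieceHi hcross κ b.depthSign 1 (b.alphaHi κ s)) ∧
        b.Ypt h s = b.pieceHi hcross κ b.depthSign 1 (b.alphaHi κ s)) ∨
      b.knotPt h s ∈ b.farSouth (min (r / 2) (min b.gapLo b.gapHi)) := by
  have hκ := h.spike.κ_pos
  set g := min (r / 2) (min b.gapLo b.gapHi)
  have hg1 : g ≤ r / 2 := min_le_left _ _
  have hg2 : g ≤ min b.gapLo b.gapHi := min_le_right _ _
  have hjl := (b.juncLo_spec hκ h.spike.seven_le_gapLo).1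
  have hjh := (b.juncHi_spec hκ h.spike.seven_le_gapHi).1
  have hε := b.epsLo_bounds.1
  have hε' := b.epsHi_bounds.1
  have far_of : ∀ {x : 𝕊 3}, x ∈ b.farSouth g → b.spikePiece hcross κ b.depthSign 1 s = (x : 𝔼 4) →
      b.knotPt h s ∈ b.farSouth g := fun hx he ↦ by
    have : b.knotPt h s = _ := Subtype.ext he
    rw [this]; exact hx
  rcases le_or_gt s (b.tcLo + b.epsLo / 8) with h1 | h1
  · -- lower core
    have hsc : s ∈ Icc (b.tcLo - b.epsLo / 8) (b.tcLo + b.epsLo / 8) := ⟨by linarith [hs.1, hjl.1], h1⟩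
    have hα : 3 / 8 ≤ b.alphaLo κ s := b.le_alphaLo_of_juncLo_le hκ h.spike.seven_le_gapLo hsc hs.1
    by_cases hq : κ * (|b.alphaLo κ s| + 1) < r
    · have he := b.spikePiece_one_coreLo h.spike hsc (norm_railLoParam_lt hκ hq)
      exact Or.inl ⟨hsc, hα, hq, (b.Ypt_eq_of_eq h he).1, (b.Ypt_eq_of_eq h he).2⟩
    · obtain ⟨x, hx, he⟩ := b.spikePiece_one_mem_farSouth_coreLo h.spike hg1 hsc hα (not_lt.1 hq)
      exact Or.inr (Or.inr (far_of hx he))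
  rcases lt_or_ge s (b.tcHi - b.epsHi / 8) with h2 | h2
  · obtain ⟨x, hx, he⟩ := b.spikePiece_one_mem_farSouth_middle h.spike hg2 ⟨h1, h2⟩
    exact Or.inr (Or.inr (far_of hx he))
  · have hsc : s ∈ Icc (b.tcHi - b.epsHi / 8) (b.tcHi + b.epsHi / 8) := ⟨h2, by linarith [hs.2, hjh.2]⟩
    have hα : 3 / 8 ≤ b.alphaHi κ s := b.le_alphaHi_of_le_juncHi hκ h.spike.seven_le_gapHi hsc hs.2
    by_cases hq : κ * (|b.alphaHi κ s| + 1) < r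
    · have he := b.spikePiece_one_coreHi h.spike hsc (norm_railHiParam_lt hκ hq)
      exact Or.inr (Or.inl ⟨hsc, hα, hq, (b.Ypt_eq_of_eq h he).1, (b.Ypt_eq_of_eq h he).2⟩)
    · obtain ⟨x, hx, he⟩ := b.spikePiece_one_mem_farSouth_coreHi h.spike hg1 hsc hα (not_lt.1 hq)
      exact Or.inr (Or.inr (far_of hx he))

variable (hA : A.InNorth)

include hA in
/-- **Wall parameters**: flat lower core (`α < 3/8`), flat upper core, or a point of the far set
lying in the open northern hemisphere. [folklore] -/
theorem wall_cases {t : ℝ} (ht : t ∈ Ico b.alo (b.alo + 1))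
    (hts : t ∉ b.contentSet h.spike.κ_pos h.spike.seven_le_gapLo h.spike.seven_le_gapHi) :
    (t ∈ Icc (b.tcLo - b.epsLo / 8) (b.tcLo + b.epsLo / 8) ∧ b.alphaLo κ t < 3 / 8 ∧
        κ * (|b.alphaLo κ t| + 1) < r ∧
        b.spikePiece hcross κ b.depthSign 1 t = ((psiN.symm (b.pieceLo hcross κ b.depthSign 1 (b.alphaLo κ t)) : 𝕊 3) : 𝔼 4)) ∨
      (t ∈ Icc (b.tcHi - b.epsHi / 8) (b.tcHi + b.epsHi / 8) ∧ b.alphaHi κ t < 3 / 8 ∧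
        κ * (|b.alphaHi κ t| + 1) < r ∧
        b.spikePiece hcross κ b.depthSign 1 t = ((psiN.symm (b.pieceHi hcross κ b.depthSign 1 (b.alphaHi κ t)) : 𝕊 3) : 𝔼 4)) ∨
      (b.spikePiece hcross κ b.depthSign 1 t ∈ b.farSet (min (r / 2) (min b.gapLo b.gapHi)) ∧
        ∃ x : 𝕊 3, b.spikePiece hcross κ b.depthSign 1 t = (x : 𝔼 4) ∧ 0 < (x : 𝔼 4) (Fin.last 3)) := by
  have hκ := h.spike.κ_pos
  have hκ4 := h.spike.κ_le_quarter
  have hjl := (b.juncLo_spec hκ h.spike.seven_le_gapLo).1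
  have hjh := (b.juncHi_spec hκ h.spike.seven_le_gapHi).1
  have hε := b.epsLo_bounds.1
  have hε' := b.epsHi_bounds.1
  have hm := b.marks_lt
  obtain ⟨hw1, hw2, -⟩ := b.tcLo_window
  obtain ⟨hw3, hw4, -⟩ := b.tcHi_window
  have hcc := b.coreLo_lt_coreHi
  set ρ₁ := min (r / 2) (min b.gapLo b.gapHi)
  have hρ₁r : ρ₁ ≤ r / 2 := min_le_left _ _
  have hρ₁lo : ρ₁ ≤ b.gapLo := (min_le_right _ _).trans (min_le_left _ _)
  have hρ₁hi : ρ₁ ≤ b.gapHi := (min_le_right _ _).trans (min_le_right _ _)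
  have h8 := h.spike.eight_lt_r
  rw [contentSet, mem_Icc, not_and_or, not_le, not_le] at hts
  rcases hts with hlt | hgt
  · -- `t < juncLo`
    rcases lt_or_ge t (b.tcLo - b.epsLo / 8) with h1 | h1
    · -- before the lower core
      refine Or.inr (Or.inr ⟨?_, b.spikePiece_one_north_of_lt h.spike hA ht h1⟩)
      have hc1 : t ∉ Icc (b.tcLo - b.epsLo / 8) (b.tcLo + b.epsLo / 8) := fun hc ↦ by linarith [hc.1]
      have hc2 : t ∉ Icc (b.tcHi - b.epsHi / 8) (b.tcHi + b.epsHi / 8) := fun hc ↦ by linarith [hc.1]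
      rw [b.spikePiece_one_of_not_core h.spike hc1 hc2]
      by_cases hn : t ∈ b.neckSet
      · rcases hn with hw | hw
        · exact b.neckPiece_mem_farSet_lowerWindow hκ4 hκ hρ₁lo hw (fun hc ↦ by linarith [hc.1])
        · exfalso; linarith [hw.1, hm.2.2.2.1]
      · exact b.neckPiece_mem_farSet_of_not_mem ρ₁ (Ico_subset_Icc_self ht) hn
    · -- in the closed lower core, left of the junction
      have htc : t ∈ Icc (b.tcLo - b.epsLo / 8) (b.tcLo + b.epsLo / 8) := ⟨h1, by linarith [hjl.2]⟩
      have hα : b.alphaLo κ t < 3 / 8 := b.alphaLo_lt_of_lt_juncLo hκ h.spike.seven_le_gapLo htc hlt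
      by_cases hq : κ * (|b.alphaLo κ t| + 1) < r
      · exact Or.inl ⟨htc, hα, hq, b.spikePiece_one_coreLo h.spike htc (norm_railLoParam_lt hκ hq)⟩
      · push Not at hq
        -- not flat: `α t < 0` and `|α t| ≥ 7`
        have hneg : b.alphaLo κ t < 0 := by
          by_contra hnn
          push Not at hnn
          rw [abs_of_nonneg hnn] at hq
          nlinarith
        have hα7 : ¬ |b.alphaLo κ t| < 7 := fun hlt7 ↦ by nlinarith
        refine Or.inr (Or.inr ⟨?_, b.spikePiece_one_north_of_alphaLo_neg h.spike hA htc hneg⟩)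
        have hα' : b.alphaLo κ t ∉ Icc (-1 : ℝ) 6 := fun hm' ↦ hα7 (b.abs_alphaLo_lt_of_mem hm')
        rw [b.spikePiece_eq_neckPiece' h.spike 1 (b.not_mem_spikeSet_of_coreLo htc hα')]
        refine b.neckPiece_mem_farSet_coreLo hκ4 hκ htc (hρ₁r.trans ?_)
        have := mul_abs_le_norm_railParam κ (b.alphaLo κ t) (-κ)
        rw [abs_of_pos hκ] at this
        nlinarith
  · -- `juncHi < t`
    rcases le_or_gt t (b.tcHi + b.epsHi / 8) with h1 | h1
    · have htc : t ∈ Icc (b.tcHi - b.epsHi / 8) (b.tcHi + b.epsHi / 8) := ⟨by linarith [hjh.1], h1⟩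
      have hα : b.alphaHi κ t < 3 / 8 := b.alphaHi_lt_of_juncHi_lt hκ h.spike.seven_le_gapHi htc hgt
      by_cases hq : κ * (|b.alphaHi κ t| + 1) < r
      · exact Or.inr (Or.inl ⟨htc, hα, hq, b.spikePiece_one_coreHi h.spike htc (norm_railHiParam_lt hκ hq)⟩)
      · push Not at hq
        have hneg : b.alphaHi κ t < 0 := by
          by_contra hnn
          push Not at hnn
          rw [abs_of_nonneg hnn] at hq
          nlinarith
        have hα7 : ¬ |b.alphaHi κ t| < 7 := fun hlt7 ↦ by nlinarith
        refine Or.inr (Or.inr ⟨?_, b.spikePiece_one_north_of_alphaHi_neg h.spike hA htc hneg⟩)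
        have hα' : b.alphaHi κ t ∉ Icc (-1 : ℝ) 6 := fun hm' ↦ hα7 (b.abs_alphaHi_lt_of_mem hm')
        rw [b.spikePiece_eq_neckPiece' h.spike 1 (b.not_mem_spikeSet_of_coreHi htc hα')]
        refine b.neckPiece_mem_farSet_coreHi hκ4 hκ htc (hρ₁r.trans ?_)
        have := mul_abs_le_norm_railParam κ (b.alphaHi κ t) κ
        rw [abs_of_pos hκ] at this
        nlinarith
    · -- after the upper core
      refine Or.inr (Or.inr ⟨?_, b.spikePiece_one_north_of_gt h.spike hA ht h1⟩)
      have hc1 : t ∉ Icc (b.tcLo - b.epsLo / 8) (b.tcLo + b.epsLo / 8) := fun hc ↦ by linarith [hc.2]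
      have hc2 : t ∉ Icc (b.tcHi - b.epsHi / 8) (b.tcHi + b.epsHi / 8) := fun hc ↦ by linarith [hc.2]
      rw [b.spikePiece_one_of_not_core h.spike hc1 hc2]
      by_cases hn : t ∈ b.neckSet
      · rcases hn with hw | hw
        · exfalso; linarith [hw.2, hm.2.2.2.1]
        · exact b.neckPiece_mem_farSet_upperWindow hκ4 hκ hρ₁hi hw (fun hc ↦ by linarith [hc.2])
      · exact b.neckPiece_mem_farSet_of_not_mem ρ₁ (Ico_subset_Icc_self ht) hn

/-! ### Depths in the flat and far regimes -/

/-- The depth of the centre is at least `κ m₀ / 2`. [folklore] -/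
theorem depth_oS_ge' (hB : B.InSouth) : κ * b.mZero / 2 ≤ depth (b.oS hcross κ b.depthSign) :=
  b.depth_oS_ge hcross hB h.spike.κ_pos.le h.centre_small

/-- The depth of the centre is positive. [folklore] -/
theorem depth_oS_pos (hB : B.InSouth) : 0 < depth (b.oS hcross κ b.depthSign) := by
  have := b.depth_oS_ge' h hB
  have := b.mZero_pos hcross hB
  have := h.spike.κ_pos
  nlinarith

/-- **The lower rail at a content parameter is in the open south**: `depth (railLoPsi κ α) > 0` for
`α > 0` on the closed lower core (flat). [folklore] -/
theorem depth_railLoPsi_pos (hB : B.InSouth) {s : ℝ} (hα : 0 < b.alphaLo κ s) (hq : ‖(pt2 (κ * b.alphaLo κ s) (-κ) : 𝔼 2)‖ < r) :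
    0 < depth (b.railLoPsi κ (b.alphaLo κ s)) := by
  have hκ := h.spike.κ_pos
  have hmem : pt2 2⁻¹ 2⁻¹ + (pt2 (κ * b.alphaLo κ s) (-κ) : 𝔼 2) ∈ squareNhd b.δ :=
    b.centre_add_mem_squareNhd (hq.trans_le (h.spike.flat.r_le.trans (b.poleRad_pos hcross).2))
  have hhalf : 2⁻¹ < (pt2 2⁻¹ 2⁻¹ + (pt2 (κ * b.alphaLo κ s) (-κ) : 𝔼 2)) 0 := by
    simp; positivity
  have hsouth := b.band_last_neg_of_half_lt hB hcross hmem hhalf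
  rw [railLoPsi, Fband, depth_pos_iff]
  exact (norm_psiN_lt_two_iff (ne_northPole_of_nonpos hsouth.le)).2 hsouth

/-- The upper rail at a content parameter is in the open south. [folklore] -/
theorem depth_railHiPsi_pos (hB : B.InSouth) {s : ℝ} (hα : 0 < b.alphaHi κ s) (hq : ‖(pt2 (κ * b.alphaHi κ s) κ : 𝔼 2)‖ < r) :
    0 < depth (b.railHiPsi κ (b.alphaHi κ s)) := by
  have hκ := h.spike.κ_pos
  have hmem : pt2 2⁻¹ 2⁻¹ + (pt2 (κ * b.alphaHi κ s) κ : 𝔼 2) ∈ squareNhd b.δ :=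
    b.centre_add_mem_squareNhd (hq.trans_le (h.spike.flat.r_le.trans (b.poleRad_pos hcross).2))
  have hhalf : 2⁻¹ < (pt2 2⁻¹ 2⁻¹ + (pt2 (κ * b.alphaHi κ s) κ : 𝔼 2)) 0 := by
    simp; positivity
  have hsouth := b.band_last_neg_of_half_lt hB hcross hmem hhalf
  rw [railHiPsi, Fband, depth_pos_iff]
  exact (norm_psiN_lt_two_iff (ne_northPole_of_nonpos hsouth.le)).2 hsouth

/-- Points of the far southern set have depth at least `κ m₀` in the chart. [folklore] -/
theorem depth_far (x : 𝕊 3) (hx : x ∈ b.farSouth (min (r / 2) (min b.gapLo b.gapHi))) : κ * b.mZero ≤ depth (psiN x) := by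
  obtain ⟨d, hd, hκd⟩ := h.far_depth
  exact hκd.trans (hd x hx)

/-! ### The cone condition -/

/-- The chart point of a chord from local flat content is within `9κ‖frame‖` of `pZero`. [folklore] -/
theorem norm_chord_sub_pZero_le {Y : 𝔼 3} (hY : ‖b.blowUp hcross κ Y‖ ≤ 7) {μ : ℝ} (hμ : μ ∈ Icc (0 : ℝ) 1) :
    ‖b.oS hcross κ b.depthSign + μ • (Y - b.oS hcross κ b.depthSign) - b.pZero‖ ≤
      9 * κ * ‖((b.frame hcross : (𝔼 3) ≃L[ℝ] 𝔼 3) : (𝔼 3) →L[ℝ] 𝔼 3)‖ := by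
  have hκ := h.spike.κ_pos
  have h1 := b.norm_sub_pZero_le hκ (hcross := hcross) (b.oS hcross κ b.depthSign + μ • (Y - b.oS hcross κ b.depthSign))
  have h2 := b.norm_blowUp_chord_le hcross hκ.ne' b.abs_depthSign_le hμ Y
  have h3 : max 2 ‖b.blowUp hcross κ Y‖ ≤ 9 := max_le (by norm_num) (by linarith)
  calc _ ≤ κ * ‖((b.frame hcross : (𝔼 3) ≃L[ℝ] 𝔼 3) : (𝔼 3) →L[ℝ] 𝔼 3)‖ * 9 := by
        refine h1.trans ?_
        exact mul_le_mul_of_nonneg_left (h2.trans h3) (mul_nonneg hκ.le (norm_nonneg _))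
    _ = _ := by ring

include hA in
/-- **THE CONE CONDITION.** In normal position (`A` north, `B` south), at a cone scale, every chord
from the centre `oS` to the chart value of a content point of the spiked knot, read back on the
sphere, avoids every wall point of the spiked knot. [folklore] -/
theorem cone (hB : B.InSouth) {s : ℝ} (hs : s ∈ b.contentSet h.spike.κ_pos h.spike.seven_le_gapLo h.spike.seven_le_gapHi)
    {μ : ℝ} (hμ : μ ∈ Icc (0 : ℝ) 1) {t : ℝ} (ht : t ∈ Ico b.alo (b.alo + 1))
    (hts : t ∉ b.contentSet h.spike.κ_pos h.spike.seven_le_gapLo h.spike.seven_le_gapHi) :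
    ((psiN.symm (b.oS hcross κ b.depthSign + μ • (b.Ypt h s - b.oS hcross κ b.depthSign)) : 𝕊 3) : 𝔼 4) ≠
      b.spikePiece hcross κ b.depthSign 1 t := by
  have hκ := h.spike.κ_pos
  have hf := h.spike.flat
  have hε := h.eps_le
  have hεn := hf.eps_nonneg
  have h8 := h.spike.eight_lt_r
  have hm0 := b.mZero_pos hcross hB
  have hoS := b.depth_oS_pos h hB
  have hoS' := b.depth_oS_ge' h hB
  set o := b.oS hcross κ b.depthSign
  intro heq
  rcases b.wall_cases h hA ht hts with ⟨htc, hαt, hqt, hwt⟩ | ⟨htc, hαt, hqt, hwt⟩ | ⟨hfar, x, hx, hxN⟩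
  · -- flat lower wall
    have hsct : κ * (|b.alphaLo κ t| + 1) < r := hqt
    have hfirst := b.blowUp_pieceLo_one_zero_lt hf hκ hε (σ := b.depthSign) hαt hsct
    rw [hwt] at heq
    have hyq := coe_psiN_symm_injective heq
    rcases b.content_cases h hs with ⟨hsc, hαs, hqs, -, hY⟩ | ⟨hsc, hαs, hqs, -, hY⟩ | hfarS
    · have hscs : κ * (|b.alphaLo κ s| + 1) < r := hqs
      have hYf := b.le_blowUp_pieceLo_one_zero hf hκ hε (σ := b.depthSign) hαs hscs
      rw [hY] at hyq
      exact b.chord_ne_of_blowUp_zero hcross hκ.ne' _ hμ hYf hfirst hyq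
    · have hscs : κ * (|b.alphaHi κ s| + 1) < r := hqs
      have hYf := b.le_blowUp_pieceHi_one_zero hf hκ hε (σ := b.depthSign) hαs hscs
      rw [hY] at hyq
      exact b.chord_ne_of_blowUp_zero hcross hκ.ne' _ hμ hYf hfirst hyq
    · -- far content against a flat lower wall
      have hYd : κ * b.mZero ≤ depth (b.Ypt h s) := b.depth_far h _ hfarS
      rcases le_or_gt 0 (b.alphaLo κ t) with hα0 | hα0
      · have hwd := b.depth_pieceLo_one_le hB hf hκ hε hα0 hαt hsct
        have hlt : depth (b.pieceLo hcross κ b.depthSign 1 (b.alphaLo κ t)) < κ * b.mZero / 2 := by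
          have : b.mZero * (3 / 8 + 11 * ε / 8) < b.mZero / 2 := by nlinarith
          nlinarith
        exact chord_ne_of_depth hoS' (by have := mul_pos hκ hm0; linarith) hμ hlt hyq
      · obtain ⟨x, hx, hxN⟩ := b.spikePiece_one_north_of_alphaLo_neg h.spike hA htc hα0
        have hYpos : 0 < depth (b.Ypt h s) := by nlinarith
        have hne := psiN_symm_chord_ne_of_north hoS hYpos hμ hxN.le
        apply hne
        apply Subtype.ext
        rw [← hx, hwt]
        exact congrArg _ (congrArg _ hyq)
  · -- flat upper wall
    have hsct : κ * (|b.alphaHi κ t| + 1) < r := hqt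
    have hfirst := b.blowUp_pieceHi_one_zero_lt hf hκ hε (σ := b.depthSign) hαt hsct
    rw [hwt] at heq
    have hyq := coe_psiN_symm_injective heq
    rcases b.content_cases h hs with ⟨hsc, hαs, hqs, -, hY⟩ | ⟨hsc, hαs, hqs, -, hY⟩ | hfarS
    · have hscs : κ * (|b.alphaLo κ s| + 1) < r := hqs
      have hYf := b.le_blowUp_pieceLo_one_zero hf hκ hε (σ := b.depthSign) hαs hscs
      rw [hY] at hyq
      exact b.chord_ne_of_blowUp_zero hcross hκ.ne' _ hμ hYf hfirst hyq
    · have hscs : κ * (|b.alphaHi κ s| + 1) < r := hqs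
      have hYf := b.le_blowUp_pieceHi_one_zero hf hκ hε (σ := b.depthSign) hαs hscs
      rw [hY] at hyq
      exact b.chord_ne_of_blowUp_zero hcross hκ.ne' _ hμ hYf hfirst hyq
    · have hYd : κ * b.mZero ≤ depth (b.Ypt h s) := b.depth_far h _ hfarS
      rcases le_or_gt 0 (b.alphaHi κ t) with hα0 | hα0
      · have hwd := b.depth_pieceHi_one_le hB hf hκ hε hα0 hαt hsct
        have hlt : depth (b.pieceHi hcross κ b.depthSign 1 (b.alphaHi κ t)) < κ * b.mZero / 2 := by
          have : b.mZero * (3 / 8 + 11 * ε / 8) < b.mZero / 2 := by nlinarith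
          nlinarith
        exact chord_ne_of_depth hoS' (by have := mul_pos hκ hm0; linarith) hμ hlt hyq
      · obtain ⟨x, hx, hxN⟩ := b.spikePiece_one_north_of_alphaHi_neg h.spike hA htc hα0
        have hYpos : 0 < depth (b.Ypt h s) := by nlinarith
        have hne := psiN_symm_chord_ne_of_north hoS hYpos hμ hxN.le
        apply hne
        apply Subtype.ext
        rw [← hx, hwt]
        exact congrArg _ (congrArg _ hyq)
  · -- far wall (north, in the far set)
    rcases b.content_cases h hs with ⟨hsc, hαs, hqs, -, hY⟩ | ⟨hsc, hαs, hqs, -, hY⟩ | hfarS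
    · by_cases h4 : b.alphaLo κ s ≤ 4
      · -- local content: the chord stays near the crossing point
        have hscs : κ * (|b.alphaLo κ s| + 1) < r := hqs
        have hε1 : ε * (|b.alphaLo κ s| + 1) ≤ 1 := by rw [abs_of_nonneg (by linarith)]; nlinarith
        have hYn : ‖b.blowUp hcross κ (b.Ypt h s)‖ ≤ 7 := by
          rw [hY]
          refine (b.norm_blowUp_pieceLo_le hf hκ ⟨zero_le_one, le_rfl⟩ _ hscs hε1).trans ?_
          rw [abs_of_nonneg (by linarith)]; linarith [b.abs_depthSign_le]
        have hnot := b.psiN_symm_not_mem_farSet_half h (b.norm_chord_sub_pZero_le h hYn hμ)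
        rw [← heq] at hfar
        exact hnot hfar
      · -- beyond the model range: the content point is a southern rail point
        push Not at h4
        have hrail : b.Ypt h s = b.railLoPsi κ (b.alphaLo κ s) := by
          rw [hY]; exact b.pieceLo_eq_rail hcross (fun hm ↦ by linarith [hm.2])
        have hYpos : 0 < depth (b.Ypt h s) := by
          rw [hrail]; exact b.depth_railLoPsi_pos h hB (by linarith) (norm_railLoParam_lt hκ hqs)
        have hne := psiN_symm_chord_ne_of_north hoS hYpos hμ hxN.le
        exact hne (Subtype.ext (heq.trans hx))
    · by_cases h4 : b.alphaHi κ s ≤ 4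
      · have hscs : κ * (|b.alphaHi κ s| + 1) < r := hqs
        have hε1 : ε * (|b.alphaHi κ s| + 1) ≤ 1 := by rw [abs_of_nonneg (by linarith)]; nlinarith
        have hYn : ‖b.blowUp hcross κ (b.Ypt h s)‖ ≤ 7 := by
          rw [hY]
          refine (b.norm_blowUp_pieceHi_le hf hκ ⟨zero_le_one, le_rfl⟩ _ hscs hε1).trans ?_
          rw [abs_of_nonneg (by linarith)]; linarith [b.abs_depthSign_le]
        have hnot := b.psiN_symm_not_mem_farSet_half h (b.norm_chord_sub_pZero_le h hYn hμ)
        rw [← heq] at hfar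
        exact hnot hfar
      · push Not at h4
        have hrail : b.Ypt h s = b.railHiPsi κ (b.alphaHi κ s) := by
          rw [hY]; exact b.pieceHi_eq_rail hcross (fun hm ↦ by linarith [hm.2])
        have hYpos : 0 < depth (b.Ypt h s) := by
          rw [hrail]; exact b.depth_railHiPsi_pos h hB (by linarith) (norm_railHiParam_lt hκ hqs)
        have hne := psiN_symm_chord_ne_of_north hoS hYpos hμ hxN.le
        exact hne (Subtype.ext (heq.trans hx))
    · have hYd : κ * b.mZero ≤ depth (b.Ypt h s) := b.depth_far h _ hfarS
      have hYpos : 0 < depth (b.Ypt h s) := by nlinarith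
      have hne := psiN_symm_chord_ne_of_north hoS hYpos hμ hxN.le
      exact hne (Subtype.ext (heq.trans hx))

end Cone

/-! ### The cone scale hypotheses hold for all small `κ` -/

/-- **Existence of cone scales**: in normal position (`B` south) there are `ε, r, A'` such that
every sufficiently small `κ > 0` is a cone scale. [folklore] -/
theorem exists_coneScale (hB : B.InSouth) :
    ∃ ε r A' κ₀ : ℝ, 0 < κ₀ ∧ ∀ κ, 0 < κ → κ ≤ κ₀ → b.ConeScale hcross ε r A' κ := by
  set N := ‖((b.frame hcross : (𝔼 3) ≃L[ℝ] 𝔼 3) : (𝔼 3) →L[ℝ] 𝔼 3)‖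
  set M := ‖((b.frame hcross).symm : (𝔼 3) →L[ℝ] 𝔼 3)‖
  have hN : 0 ≤ N := norm_nonneg _
  have hM : 0 ≤ M := norm_nonneg _
  have hσ : |b.depthSign| ≤ 1 := b.abs_depthSign_le
  have hm0 := b.mZero_pos hcross hB
  -- the blown-up range
  set A' : ℝ := 7 + 18 * N * M + 1 with hA'
  have hA7 : 7 ≤ A' := by have := mul_nonneg (mul_nonneg (by norm_num : (0:ℝ) ≤ 18) hN) hM; linarith
  have hA0 : 0 < A' + 1 := by linarith
  -- the tolerance, now at most `1/16`
  obtain ⟨hB0, -⟩ := bumpBound_spec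
  set ε : ℝ := min (1 / 16) (min (5 / (6 * (A' + 1))) (1 / (2 * (1 + bumpBound * (A' + 1))))) with hε
  have hε0 : 0 < ε := lt_min (by norm_num) (lt_min (by positivity) (by positivity))
  have hε16 : ε ≤ 1 / 16 := min_le_left _ _
  have hε2 : ε * (A' + 1) ≤ 5 / 6 := by
    have : ε ≤ 5 / (6 * (A' + 1)) := (min_le_right _ _).trans (min_le_left _ _)
    rw [le_div_iff₀ (by positivity)] at this; linarith
  have hε3 : ε * (1 + bumpBound * (A' + 1)) ≤ 1 / 2 := by
    have hpos : 0 < 1 + bumpBound * (A' + 1) := by positivity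
    have : ε ≤ 1 / (2 * (1 + bumpBound * (A' + 1))) := (min_le_right _ _).trans (min_le_right _ _)
    rw [le_div_iff₀ (by positivity)] at this; linarith
  have hbig : 9 * N * M < (1 - ε) * A' := by
    have h1 : (1 : ℝ) / 2 ≤ 1 - ε := by linarith
    have h2 : 9 * N * M < (1 / 2) * A' := by rw [hA']; nlinarith [mul_nonneg hN hM]
    nlinarith [mul_nonneg hN hM]
  -- the flatness radius
  obtain ⟨r, hf⟩ := b.exists_isFlat hcross hε0
  have hr := hf.r_pos
  -- the far distances and the continuity radius
  set ρ₁ := min r (min b.gapLo b.gapHi)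
  set ρ₂ := min (r / 2) (min b.gapLo b.gapHi)
  have hρ₁ : 0 < ρ₁ := lt_min hr (lt_min b.gapLo_pos b.gapHi_pos)
  have hρ₂ : 0 < ρ₂ := lt_min (by linarith) (lt_min b.gapLo_pos b.gapHi_pos)
  obtain ⟨m₁, hm₁, hfar₁⟩ := b.exists_farDist hρ₁
  obtain ⟨m₂, hm₂, hfar₂⟩ := b.exists_farDist hρ₂
  have hcont : ContinuousAt (fun y : 𝔼 3 ↦ ((psiN.symm y : 𝕊 3) : 𝔼 4)) b.pZero :=
    contDiff_coe_psiN_symm.continuous.continuousAt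
  have hc0 : ((psiN.symm b.pZero : 𝕊 3) : 𝔼 4) = ((b.crossPt : 𝕊 3) : 𝔼 4) := by
    rw [b.pZero_eq, psiN_symm_apply_psiN (ne_northPole_of_nonpos (b.crossPt_last_eq_zero hcross).le)]
  obtain ⟨ρ₀, hρ₀, hball⟩ := Metric.continuousAt_iff.1 hcont (min m₁ m₂) (lt_min hm₁ hm₂)
  -- the far southern depth
  obtain ⟨d, hd, hdepth⟩ := b.exists_depth_farSouth hcross hB hρ₂
  -- the scale bound
  set C₀ := ‖b.frame hcross (pt3 1 0 b.depthSign)‖ ^ 2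
  have hC₀ : 0 ≤ C₀ := sq_nonneg _
  set κ₀ : ℝ := min (1 / 12) (min (r / (2 * (A' + 1))) (min (b.gapLo / (A' + 1)) (min (b.gapHi / (A' + 1))
    (min (ρ₀ / (2 * (9 * N + 1))) (min (b.mZero / (2 * (C₀ + 1))) (d / b.mZero)))))) with hκ₀
  have hκ₀pos : 0 < κ₀ := by
    refine lt_min (by norm_num) (lt_min (by positivity) (lt_min (div_pos b.gapLo_pos hA0)
      (lt_min (div_pos b.gapHi_pos hA0) (lt_min (by positivity) (lt_min (by positivity) (div_pos hd hm0))))))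
  refine ⟨ε, r, A', κ₀, hκ₀pos, fun κ hκ hκle ↦ ?_⟩
  have k1 : κ ≤ 1 / 12 := hκle.trans (min_le_left _ _)
  have t2 := hκle.trans (min_le_right _ _)
  have k2 : κ ≤ r / (2 * (A' + 1)) := t2.trans (min_le_left _ _)
  have t3 := t2.trans (min_le_right _ _)
  have k3 : κ ≤ b.gapLo / (A' + 1) := t3.trans (min_le_left _ _)
  have t4 := t3.trans (min_le_right _ _)
  have k4 : κ ≤ b.gapHi / (A' + 1) := t4.trans (min_le_left _ _)
  have t5 := t4.trans (min_le_right _ _)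
  have k5 : κ ≤ ρ₀ / (2 * (9 * N + 1)) := t5.trans (min_le_left _ _)
  have t6 := t5.trans (min_le_right _ _)
  have k6 : κ ≤ b.mZero / (2 * (C₀ + 1)) := t6.trans (min_le_left _ _)
  have k7 : κ ≤ d / b.mZero := t6.trans (min_le_right _ _)
  rw [le_div_iff₀ (by positivity)] at k2 k5 k6
  rw [le_div_iff₀ hA0] at k3 k4
  rw [le_div_iff₀ hm0] at k7
  have hballs : ∀ y : 𝔼 3, ‖y - b.pZero‖ < ρ₀ → ‖((psiN.symm y : 𝕊 3) : 𝔼 4) - ((b.crossPt : 𝕊 3) : 𝔼 4)‖ < min m₁ m₂ := by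
    intro y hy
    have := hball (by rwa [dist_eq_norm])
    rwa [dist_eq_norm, hc0] at this
  have e5 : κ * (2 * (9 * N + 1)) = 2 * (9 * κ * N) + 2 * κ := by ring
  have hκρ : 9 * κ * N < ρ₀ := by linarith
  have hAr : κ * (A' + 1) < r := by linarith
  have hS : b.SpikeScale hcross b.depthSign ε r A' κ :=
    ⟨hf, hκ, k1, hσ, hA7, hAr, k3, k4, hε3, hε2, hbig, m₁, ρ₀, hfar₁,
      fun y hy ↦ (hballs y hy).trans_le (min_le_left _ _), hκρ⟩
  have e6 : κ * (2 * (C₀ + 1)) = 2 * (κ * C₀) + 2 * κ := by ring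
  have hcs : κ * C₀ ≤ b.mZero / 2 := by linarith
  exact ⟨hS, hε16, hcs, ⟨d, hdepth, k7⟩, ⟨m₂, ρ₀, hfar₂, fun y hy ↦ (hballs y hy).trans_le (min_le_right _ _), hκρ⟩⟩

end BandData

end Literature.Topology.FourManifolds
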